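import Literature.Computability.Complexity.StackHarveyMain
import Literature.Computability.Complexity.HarveyTorsionSupply
import Literature.Computability.Complexity.CRRFacts
import Literature.Computability.Complexity.StackMachinesTM2
import Literature.Computability.Complexity.Transducers
import Literature.Computability.Cryptography.Harvey2021Bridge
import HarnessLib

/-!
# Harvey's deterministic `N^{1/5+o(1)}` factoring machine: correctness, running time, the Turing machine

Literature / complexity toolkit, the last file of the series building D. Harvey's deterministic
integer factoring algorithm (Math. Comp. 90 (2021), arXiv:2010.05450) on Mathlib's multi-stack
Turing machines (`StackHarveyMain.lean`: the register-level machine `mainProg` and its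
specification `runs_main`).  This file proves:

* **correctness** — the arithmetic of the machine: trial division (`tdRun_inv`), soundness and
  completeness of the per-number procedure (`coreOut_sound`, `coreOut_complete`: a reported value
  is a proper divisor; "no factor" means prime — at most two prime factors after the first base
  search, not a square, the small prime large after the second, then the order search and
  Algorithm 2, `a2Out_complete`), the invariant of the work stack (`roundsRun_inv`,
  `rounds_hyps`), the exclusion of exhausted base searches above the threshold `n₀ = 4096` by
  the counting of products of short primes (`sf_exhaust_bound`, `supply_facts`, using
  `HarveyTorsionSupply` and the Chebyshev bound of `CRRFacts`), the potential argument bounding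
  the number of rounds (`roundsRun_full`, `roundsOf_fst_nil`), and finally
  **`factorOut_eq : factorOut N = Nat.primeFactorsList N`**;
* **running time** — closed-form bounds on every cost function of the toolkit (Bluestein's
  transform, the product tree, Algorithm 1, the base search, Algorithm 2 with Harvey's candidate
  count `Σ_{ab ≤ r} J_{a,b}` (`pairSum_le`, from `Harvey2021Search.candidate_count_le`), the
  per-number procedure, trial division, the rounds), giving
  **`mainCost_le : mainCost N ≤ 2^{n₀} · 10¹² · 2^{⌊n/5⌋} · (4n+25)^{10}`** (`n = |enc N|`);
* **the Turing machine** — compilation to a `TM2` machine (`factorMachine`,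
  `factorMachine_outputsWithin`), the linear-time transducer to the `Option Bool` list coding
  (`sepFST`, `sepFST_eval`), and their composition: **`exists_factoring_machine`**, a
  `TM2ComputableInTime encodeNat encodeListNat Nat.primeFactorsList` with time
  `O(2^{n/5} (n+1)^{12})` — the hypothesis of `Harvey2021Bridge.harvey_factoring_one_fifth_of_time_bound_poly`.

Every theorem is proved; no named facts.

## References

* D. Harvey, *An exponent one-fifth algorithm for deterministic integer factorisation*,
  Math. Comp. 90 (2021) 2937–2950; arXiv:2010.05450 v3, Thm. 1, Props. 2, 14–16, Lemma 9,
  Algorithms 1–3 and the proof of Thm. 1 on p. 10. [Harvey2021]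
* R. Crandall, C. Pomerance, *Prime Numbers: A Computational Perspective*, 2nd ed., Springer
  2005, §3.1 (trial division), §5.3 (baby steps, giant steps). (Folklore material, fully proved here.)
-/

namespace Literature.Computability.Complexity

open _root_.Computability SProg

namespace Com

variable {β : Type} [DecidableEq β] (h : HReg ↪ β)

section TrialDivisionMath

/-! ### What trial division proves

`tdRun N nb T` from `(N, [])` over the divisors `2, …, T + 1` (with `nb` division rounds each,
`2^{nb} > N ≥ 1`): the emitted list consists of primes, in increasing order, its product times
the cofactor is `N`, and no prime `≤ T + 1` divides the cofactor. -/

/-- One division round keeps `X · ∏ out`. [folklore] -/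
theorem tdStep_prod (t : ℕ) (s : ℕ × List ℕ) : (tdStep t s).1 * (tdStep t s).2.prod = s.1 * s.2.prod := by
  unfold tdStep
  split_ifs with hd
  · simp only [List.prod_append, List.prod_cons, List.prod_nil, mul_one]
    rw [mul_comm (s.2.prod) t, ← mul_assoc, Nat.div_mul_cancel (Nat.dvd_of_mod_eq_zero hd)]
  · rfl

/-- The rounds keep `X · ∏ out`. [folklore] -/
theorem tdRounds_prod (t : ℕ) : ∀ (k : ℕ) (s : ℕ × List ℕ), (tdRounds t k s).1 * (tdRounds t k s).2.prod = s.1 * s.2.prod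
  | 0, s => rfl
  | k + 1, s => by rw [tdRounds, tdRounds_prod t k, tdStep_prod]

/-- **Trial division keeps the product**: cofactor times the emitted divisors is `N`. [folklore] -/
theorem tdRun_prod (N nb : ℕ) : ∀ j, (tdRun N nb j).1 * (tdRun N nb j).2.prod = N
  | 0 => by simp [tdRun]
  | j + 1 => by rw [tdRun, tdRounds_prod, tdRun_prod N nb j]

/-- If `t` still divides the cofactor after `k` rounds, every round divided: `X_k · t^k = X`. [folklore] -/
theorem tdRounds_dvd_mul (t : ℕ) : ∀ (k : ℕ) (s : ℕ × List ℕ), t ∣ (tdRounds t k s).1 → (tdRounds t k s).1 * t ^ k = s.1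
  | 0, s, _ => by simp [tdRounds]
  | k + 1, s, hd => by
    rw [tdRounds] at hd ⊢
    have ih := tdRounds_dvd_mul t k (tdStep t s) hd
    -- the first round divided, else nothing would ever change
    have hfix : ∀ (j : ℕ) (s' : ℕ × List ℕ), ¬ s'.1 % t = 0 → tdRounds t j s' = s' := by
      intro j; induction j with
      | zero => intro s' _; rfl
      | succ j ihj => intro s' hs'; rw [tdRounds, show tdStep t s' = s' by unfold tdStep; rw [if_neg hs']]; exact ihj s' hs'
    by_cases h0 : s.1 % t = 0
    · have hstep : (tdStep t s).1 = s.1 / t := by unfold tdStep; rw [if_pos h0]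
      rw [hstep] at ih
      rw [pow_succ, ← mul_assoc, ih, Nat.div_mul_cancel (Nat.dvd_of_mod_eq_zero h0)]
    · exfalso
      have hs : tdStep t s = s := by unfold tdStep; rw [if_neg h0]
      rw [hs, hfix k s h0] at hd
      exact h0 (Nat.mod_eq_zero_of_dvd hd)

/-- After `nb` rounds with `2^{nb} > X ≥ 1` and `t ≥ 2`, `t` no longer divides the cofactor. [folklore] -/
theorem tdRounds_not_dvd {t nb : ℕ} (ht : 2 ≤ t) (s : ℕ × List ℕ) (hX1 : 1 ≤ s.1) (hX : s.1 < 2 ^ nb) : ¬ t ∣ (tdRounds t nb s).1 := by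
  intro hd
  have hmul := tdRounds_dvd_mul t nb s hd
  have hpos : 1 ≤ (tdRounds t nb s).1 := by
    rcases Nat.eq_zero_or_pos (tdRounds t nb s).1 with h0 | h0
    · rw [h0, zero_mul] at hmul; omega
    · exact h0
  have h1 : t ^ nb ≤ s.1 := by rw [← hmul]; exact Nat.le_mul_of_pos_left _ hpos
  have h2 : 2 ^ nb ≤ t ^ nb := Nat.pow_le_pow_left ht nb
  omega

/-- The cofactor only loses divisors. [folklore] -/
theorem tdRounds_fst_dvd (t : ℕ) : ∀ (k : ℕ) (s : ℕ × List ℕ), (tdRounds t k s).1 ∣ s.1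
  | 0, s => dvd_rfl
  | k + 1, s => by
    rw [tdRounds]
    refine (tdRounds_fst_dvd t k (tdStep t s)).trans ?_
    unfold tdStep; split_ifs with hd
    · exact Nat.div_dvd_of_dvd (Nat.dvd_of_mod_eq_zero hd)
    · exact dvd_rfl

/-- The cofactor stays positive. [folklore] -/
theorem tdRounds_fst_pos {t : ℕ} (ht : 1 ≤ t) : ∀ (k : ℕ) (s : ℕ × List ℕ), 1 ≤ s.1 → 1 ≤ (tdRounds t k s).1
  | 0, s, hs => hs
  | k + 1, s, hs => by
    rw [tdRounds]
    refine tdRounds_fst_pos ht k (tdStep t s) ?_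
    unfold tdStep; split_ifs with hd
    · exact Nat.div_pos (Nat.le_of_dvd hs (Nat.dvd_of_mod_eq_zero hd)) (by omega)
    · exact hs

/-- **The invariant of trial division** after the divisors `2, …, j + 1` (for `1 ≤ N < 2^{nb}`): the
emitted divisors are primes `≤ j + 1` in non-decreasing order, and no prime `≤ j + 1` divides the
cofactor. [folklore] -/
theorem tdRun_inv {N nb : ℕ} (hN1 : 1 ≤ N) (hN : N < 2 ^ nb) : ∀ j,
    1 ≤ (tdRun N nb j).1 ∧ (∀ x ∈ (tdRun N nb j).2, x.Prime ∧ x ≤ j + 1) ∧ (tdRun N nb j).2.Pairwise (· ≤ ·) ∧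
    (∀ p, p.Prime → p ≤ j + 1 → ¬ p ∣ (tdRun N nb j).1)
  | 0 => ⟨by simp only [tdRun]; exact hN1, by simp [tdRun], by simp [tdRun], fun p hp hp1 => absurd hp1 (by have := hp.two_le; omega)⟩
  | j + 1 => by
    obtain ⟨ih1, ih2, ih3, ih4⟩ := tdRun_inv hN1 hN j
    set s := tdRun N nb j with hs
    have hsN : s.1 ≤ N := (tdRun_facts N nb j).1
    rw [tdRun]
    set t := j + 2 with ht
    obtain ⟨g1, g2, -⟩ := tdRounds_facts t nb s
    have hdiv : (tdRounds t nb s).1 ∣ s.1 := tdRounds_fst_dvd t nb s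
    refine ⟨tdRounds_fst_pos (by omega) nb s ih1, fun x hx => ?_, ?_, fun p hp hpt hpd => ?_⟩
    · rcases g2 x hx with hx | rfl
      · have := ih2 x hx; exact ⟨this.1, by omega⟩
      · -- the emitted divisor `t` is prime: a smaller prime factor would divide the cofactor
        refine ⟨?_, le_rfl⟩
        by_contra hnp
        obtain ⟨p, hp, hpt⟩ := Nat.exists_prime_and_dvd (show t ≠ 1 by omega)
        have hplt : p < t := lt_of_le_of_ne (Nat.le_of_dvd (by omega) hpt) (fun he => hnp (he ▸ hp))
        -- `t` was emitted, so `t ∣ X` at some round, hence `p ∣ X_j`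
        have hemit : t ∣ s.1 := by
          -- if `t ∤ s.1` nothing is emitted in these rounds
          by_contra hnd
          have hfix : ∀ (k : ℕ) (s' : ℕ × List ℕ), ¬ t ∣ s'.1 → tdRounds t k s' = s' := by
            intro k; induction k with
            | zero => intro s' _; rfl
            | succ k ihk => intro s' hs'; rw [tdRounds, show tdStep t s' = s' by unfold tdStep; rw [if_neg (fun h0 => hs' (Nat.dvd_of_mod_eq_zero h0))]]; exact ihk s' hs'
          rw [hfix nb s hnd] at hx
          have := (ih2 t hx).2; omega
        exact ih4 p hp (by omega) (hpt.trans hemit)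
    · -- sorted: the new divisors `t` exceed everything before
      have hshape : ∃ k, (tdRounds t nb s).2 = s.2 ++ List.replicate k t := by
        have gen : ∀ (k : ℕ) (s' : ℕ × List ℕ), ∃ m, (tdRounds t k s').2 = s'.2 ++ List.replicate m t := by
          intro k; induction k with
          | zero => intro s'; exact ⟨0, by simp [tdRounds]⟩
          | succ k ihk =>
            intro s'; rw [tdRounds]
            obtain ⟨m, hm⟩ := ihk (tdStep t s')
            unfold tdStep at hm ⊢
            split_ifs at hm ⊢ with hd
            · exact ⟨m + 1, by rw [hm]; simp [List.replicate_succ, List.append_assoc]⟩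
            · exact ⟨m, hm⟩
        exact gen nb s
      obtain ⟨k, hk⟩ := hshape
      rw [hk]
      refine List.pairwise_append.2 ⟨ih3, ?_, fun a ha b hb => ?_⟩
      · exact List.pairwise_replicate.2 (Or.inr (le_refl t))
      · rw [List.eq_of_mem_replicate hb]; have := (ih2 a ha).2; omega
    · rcases Nat.lt_or_ge p (t) with hlt | hge
      · exact ih4 p hp (by omega) (hpd.trans hdiv)
      · have hpt' : p = t := by omega
        subst hpt'
        exact tdRounds_not_dvd (by omega) s ih1 (lt_of_le_of_lt hsN hN) hpd

end TrialDivisionMath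

section CoreSoundness

/-! ### What the per-number procedure proves, I: a reported value is a proper divisor -/

/-- The stopped base of a stopped search is `≥ 2`, and the code is that of the stop. [folklore] -/
theorem sfRun_stop_facts (N e LB M : ℕ) : ∀ j out, (sfRun N e LB M j).2.2 = some out → 2 ≤ (sfRun N e LB M j).1
  | 0, out, h0 => by simp [sfRun] at h0
  | j + 1, out, h0 => by
    rcases hst : sfRun N e LB M j with ⟨α, L, r⟩
    cases r with
    | some out' => rw [sfRun_succ_some hst] at h0 ⊢; have := sfRun_stop_facts N e LB M j out' (by rw [hst]); rw [hst] at this; exact this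
    | none =>
      rw [sfRun_succ_none hst] at h0 ⊢
      have hα := (sfRun_spec_fst_none N e LB M j hst)
      split_ifs at h0 ⊢
      · simp; omega
where
  /-- helper: the base counter while searching -/
  sfRun_spec_fst_none (N e LB M : ℕ) : ∀ j {α L}, sfRun N e LB M j = (α, L, none) → α = 1 + j
  | 0, α, L, h0 => by simp [sfRun] at h0; exact h0.1.symm
  | j + 1, α, L, h0 => by
    rcases hst : sfRun N e LB M j with ⟨α', L', r⟩
    cases r with
    | some out' => rw [sfRun_succ_some hst] at h0; simp at h0
    | none =>
      rw [sfRun_succ_none hst] at h0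
      have ih := sfRun_spec_fst_none N e LB M j hst
      split_ifs at h0 with hs
      · simp at h0
      · simp only [Prod.mk.injEq] at h0; omega

/-- **Soundness of the per-number procedure**: on a good `X`, a reported value is a proper divisor. [folklore] -/
theorem coreOut_sound {X B n g : ℕ} (hG : GoodX n B X) (hg : coreOut X B = some g) : 1 < g ∧ g < X ∧ g ∣ X := by
  obtain ⟨hXodd, hX1, -, hnX, -, hcop⟩ := hG
  have hX0 : 0 < X := by omega
  have hsf : ∀ e LB M, 1 ≤ LB → ∀ g', sfFac (sfRun X e LB M B) = some g' → 1 < g' ∧ g' < X ∧ g' ∣ X := fun e LB M hLB g' hg' =>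
    (sfRun_outcome_facts (e := e) (LB := LB) (M := M) (B := B) hXodd hX1 hLB hcop).2.2.2.2 g' hg'
  unfold coreOut at hg
  rcases Option.or_eq_some_iff.1 hg with hg | ⟨-, hg⟩
  · rcases Option.or_eq_some_iff.1 hg with hg | ⟨-, hg⟩
    · rcases Option.or_eq_some_iff.1 hg with hg | ⟨-, hg⟩
      · exact hsf _ _ _ Nat.one_le_two_pow g hg
      · unfold sqFac at hg
        split_ifs at hg with hs
        obtain rfl := Option.some.inj hg
        have hg1 : 1 < Nat.sqrt X := by
          by_contra h1; push Not at h1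
          have : Nat.sqrt X * Nat.sqrt X ≤ 1 := by nlinarith
          omega
        exact ⟨hg1, by nlinarith, ⟨Nat.sqrt X, hs.symm⟩⟩
    · exact hsf _ _ _ Nat.one_le_two_pow g hg
  · unfold stage45Out at hg
    rcases Option.or_eq_some_iff.1 hg with hg | ⟨-, hg⟩
    · exact hsf _ _ _ Nat.one_le_two_pow g hg
    · split_ifs at hg with hc
      -- Algorithm 2 after a clear order search: `ord_p(α) > 4^{e₃} ≥ m` for every prime factor
      set nX := (encodeNat X).length with hnX0
      set st := stage4St X B with hst0
      have hst : st = sfRun X (cE3 nX) (2 ^ cL3 nX) (Nat.sqrt X) B := by rw [hst0, stage4St]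
      obtain ⟨out, hout, hcode⟩ : ∃ out, st.2.2 = some out ∧ out.code = 2 := by
        simp only [sfCode] at hc; rcases hq : st.2.2 with _ | out
        · rw [hq] at hc; simp at hc
        · rw [hq] at hc; exact ⟨out, rfl, hc⟩
      obtain ⟨-, -, -, -, hclear, -, -, -⟩ := sfRun_spec (e := cE3 nX) (LB := 2 ^ cL3 nX) (M := Nat.sqrt X) hXodd hX1 Nat.one_le_two_pow hcop B le_rfl
      rw [← hst] at hclear
      have hm : 2 ^ cER nX ≤ 2 ^ cE3 nX * 2 ^ cE3 nX := by
        rw [← pow_add]; apply Nat.pow_le_pow_right (by omega); simp only [cER, cE3]; omega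
      have hord : ∀ i, 1 ≤ i → i < 2 ^ cER nX → ((st.1 : ℕ) : ZMod X) ^ i ≠ 1 := by
        intro i hi1 him heq
        obtain ⟨p, hp, hpX⟩ := Nat.exists_prime_and_dvd (show X ≠ 1 by omega)
        have h1 := hclear out hout hcode p hp hpX i hi1 (by omega)
        apply h1
        have := congrArg (ZMod.castHom hpX (ZMod p)) heq
        rwa [map_pow, map_natCast, map_one] at this
      exact a2Out_factor hX1 hord hg

end CoreSoundness

section Regime

/-! ### The regime of the parameters

Above the threshold (`n₀ ≤ |enc N|`): the number of bases `B = 2^{4|enc |enc N||+8}` is at most the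
number of trial divisors `2^{tE}`, and `tE ≥ 10`; below it, trial division is complete. -/

/-- The key numeric inequality of the regime. [folklore] -/
theorem regime_key {L : ℕ} (hL : 13 ≤ L) : 180 * L + 600 ≤ 2 ^ (L - 1) := by
  obtain ⟨k, rfl⟩ : ∃ k, L = 13 + k := ⟨L - 13, by omega⟩
  induction k with
  | zero => norm_num
  | succ k ih => rw [show 13 + (k + 1) - 1 = (13 + k - 1) + 1 by omega, pow_succ]; omega

/-- Above the threshold, `|enc nN| ≥ 13` and `180 |enc nN| + 600 ≤ nN < 2^{|enc nN|}`. [folklore] -/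
theorem regime_len {nN : ℕ} (hreg : n₀ ≤ nN) : 13 ≤ (encodeNat nN).length ∧ 180 * (encodeNat nN).length + 600 ≤ nN ∧ nN < 2 ^ (encodeNat nN).length := by
  rw [TM2Pass.length_encodeNat_eq_size]
  have h13 : 13 ≤ Nat.size nN := by
    have := Nat.size_le_size hreg; rw [show n₀ = 2 ^ 12 by rfl, Nat.size_pow] at this; exact this
  refine ⟨h13, (regime_key h13).trans ?_, Nat.lt_size_self nN⟩
  exact Nat.lt_size.1 (by omega)

/-- Above the threshold: `bE ≤ tE` and `10 ≤ tE`. [folklore] -/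
theorem regime_exps {nN : ℕ} (hreg : n₀ ≤ nN) : bE nN ≤ tE nN ∧ 10 ≤ tE nN := by
  obtain ⟨h13, hk, -⟩ := regime_len hreg
  simp only [bE, tE, if_pos hreg]; omega

/-- The cofactor of trial division and its prime factors. [folklore] -/
theorem tdOf_facts {N : ℕ} (hN : 1 ≤ N) :
    1 ≤ (tdOf N).1 ∧ (tdOf N).1 ≤ N ∧ (∀ p, p.Prime → p ∣ (tdOf N).1 → 2 ^ tE (encodeNat N).length + 2 ≤ p) ∧
    (∀ x ∈ (tdOf N).2, x.Prime ∧ x ≤ 2 ^ tE (encodeNat N).length + 1) ∧ (tdOf N).2.Pairwise (· ≤ ·) ∧ (tdOf N).1 * (tdOf N).2.prod = N := by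
  have hNlt : N < 2 ^ (encodeNat N).length := by rw [TM2Pass.length_encodeNat_eq_size]; exact Nat.lt_size_self N
  obtain ⟨i1, i2, i3, i4⟩ := tdRun_inv hN hNlt (2 ^ tE (encodeNat N).length)
  refine ⟨i1, (tdRun_facts N _ _).1, fun p hp hpd => ?_, fun x hx => i2 x hx, i3, tdRun_prod N _ _⟩
  by_contra hlt; exact i4 p hp (by omega) hpd

/-- Below the threshold, trial division is complete: the cofactor is `1`. [folklore] -/
theorem tdOf_fst_eq_one {N : ℕ} (hN : 1 ≤ N) (hreg : ¬ n₀ ≤ (encodeNat N).length) : (tdOf N).1 = 1 := by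
  obtain ⟨h1, hle, hp, -⟩ := tdOf_facts hN
  by_contra hne
  obtain ⟨p, hpp, hpd⟩ := Nat.exists_prime_and_dvd hne
  have h2 := hp p hpp hpd
  have h3 : p ≤ N := (Nat.le_of_dvd (by omega) hpd).trans hle
  have hNlt : N < 2 ^ (encodeNat N).length := by rw [TM2Pass.length_encodeNat_eq_size]; exact Nat.lt_size_self N
  simp only [tE, if_neg hreg] at h2; omega

/-- **Divisors `> 1` of the cofactor are good.** [folklore] -/
theorem goodX_of_dvd {N X : ℕ} (hN : 1 ≤ N) (hX1 : 1 < X) (hXd : X ∣ (tdOf N).1) : GoodX (nPar N) (bOf N) X := by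
  set nN := (encodeNat N).length with hnN
  obtain ⟨hf1, hfN, hfp, -⟩ := tdOf_facts hN
  have hXle : X ≤ (tdOf N).1 := Nat.le_of_dvd (by omega) hXd
  by_cases hreg : n₀ ≤ nN
  · obtain ⟨hbt, ht10⟩ := regime_exps hreg
    set Tn := 2 ^ tE nN with hTn
    have hprime : ∀ p, p.Prime → p ∣ X → Tn + 2 ≤ p := fun p hp hpX => hfp p hp (hpX.trans hXd)
    obtain ⟨p₀, hp₀, hp₀X⟩ := Nat.exists_prime_and_dvd (show X ≠ 1 by omega)
    have hXge : Tn + 2 ≤ X := (hprime p₀ hp₀ hp₀X).trans (Nat.le_of_dvd (by omega) hp₀X)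
    have hB : bOf N ≤ Tn := by rw [bOf, hTn]; exact Nat.pow_le_pow_right (by omega) hbt
    refine ⟨?_, hX1, ?_, ?_, by omega, fun a ha2 haB => ?_⟩
    · refine Nat.odd_iff.2 (Nat.two_dvd_ne_zero.1 fun h2 => ?_)
      have := hprime 2 Nat.prime_two h2; have := Nat.one_le_two_pow (n := tE nN); omega
    · have := Brick.length_encodeNat_mono (hXle.trans hfN); rw [nPar]; omega
    · have h9 : 2 ^ 9 ≤ X := (Nat.pow_le_pow_right (by omega) (show 9 ≤ tE nN by omega)).trans (by omega)
      rw [TM2Pass.length_encodeNat_eq_size]; exact Nat.lt_size.2 h9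
    · refine Nat.coprime_of_dvd fun k hk hka hkX => ?_
      have h1 := hprime k hk hkX
      have h2 : k ≤ a := Nat.le_of_dvd (by omega) hka
      omega
  · exfalso
    rw [tdOf_fst_eq_one hN hreg] at hXle; omega

/-- **The invariant of the rounds**: every number on the stack, and every reported prime, is a
divisor `> 1` of the cofactor. [folklore] -/
theorem roundsRun_inv {n B Xf : ℕ} (hgood : ∀ X, 1 < X → X ∣ Xf → GoodX n B X) : ∀ k,
    (∀ X ∈ (roundsRun B (stack0 Xf, []) k).1, 1 < X ∧ X ∣ Xf) ∧ (∀ p ∈ (roundsRun B (stack0 Xf, []) k).2, 1 < p ∧ p ∣ Xf)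
  | 0 => by
    refine ⟨fun X hX => ?_, by simp [roundsRun]⟩
    simp only [roundsRun, stack0] at hX
    split_ifs at hX with h1
    · simp at hX
    · simp only [List.mem_singleton] at hX; subst hX; exact ⟨by omega, dvd_rfl⟩
  | k + 1 => by
    obtain ⟨ih1, ih2⟩ := roundsRun_inv hgood k
    rw [roundsRun]
    rcases hs : roundsRun B (stack0 Xf, []) k with ⟨stk, ps⟩
    rw [hs] at ih1 ih2
    cases stk with
    | nil => exact ⟨fun X hX => absurd hX (by simp), fun p hp => ih2 p (by simpa using hp)⟩
    | cons X rest =>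
      obtain ⟨hX1, hXd⟩ := ih1 X (by simp)
      simp only [roundStep]
      rcases hq : coreOut X B with _ | g
      · exact ⟨fun Y hY => ih1 Y (List.mem_cons_of_mem _ hY), fun p hp => by
          rcases List.mem_cons.1 hp with rfl | hp
          · exact ⟨hX1, hXd⟩
          · exact ih2 p hp⟩
      · obtain ⟨hg1, hgX, hgd⟩ := coreOut_sound (hgood X hX1 hXd) hq
        refine ⟨fun Y hY => ?_, ih2⟩
        rcases List.mem_cons.1 hY with rfl | hY
        · exact ⟨hg1, hgd.trans hXd⟩
        rcases List.mem_cons.1 hY with rfl | hY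
        · refine ⟨?_, (Nat.div_dvd_of_dvd hgd).trans hXd⟩
          by_contra hle; push Not at hle
          have := Nat.div_mul_cancel hgd
          have : X / g * g ≤ 1 * g := Nat.mul_le_mul_right g hle
          omega
        · exact ih1 Y (List.mem_cons_of_mem _ hY)

/-- **The hypotheses of the machine theorem**: the numbers the rounds meet are good, the primes
they report are `≤ N`. [folklore] -/
theorem rounds_hyps (N : ℕ) :
    (∀ k, k ≤ 7 → ∀ X ∈ (roundsRun (bOf N) (stack0 (tdOf N).1, []) k).1, GoodX (nPar N) (bOf N) X) ∧ (∀ p ∈ (roundsOf N).2, p ≤ N) := by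
  rcases Nat.eq_zero_or_pos N with rfl | hN
  · -- `N = 0`: the stack is empty throughout
    have h0 : (tdOf 0).1 = 0 := Nat.le_zero.1 (tdRun_facts 0 _ _).1
    have hem : ∀ k, roundsRun (bOf 0) (stack0 (tdOf 0).1, []) k = ([], []) := by
      intro k; induction k with
      | zero => simp [roundsRun, stack0, h0]
      | succ k ih => rw [roundsRun, ih]
    refine ⟨fun k _ X hX => ?_, fun p hp => ?_⟩
    · rw [hem] at hX; simp at hX
    · rw [roundsOf, hem] at hp; simp at hp
  · have hgood : ∀ X, 1 < X → X ∣ (tdOf N).1 → GoodX (nPar N) (bOf N) X := fun X => goodX_of_dvd hN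
    refine ⟨fun k _ X hX => ?_, fun p hp => ?_⟩
    · obtain ⟨h1, h2⟩ := (roundsRun_inv hgood k).1 X hX; exact hgood X h1 h2
    · obtain ⟨-, h2⟩ := (roundsRun_inv hgood 7).2 p hp
      exact (Nat.le_of_dvd (tdOf_facts hN).1 h2).trans (tdOf_facts hN).2.1

end Regime

section CoreCompleteness

/-! ### What the per-number procedure proves, II: "no factor" means prime

(under the invariants of the rounds, and provided none of the three base searches exhausts its
bases — which the counting argument of the sequel excludes above the threshold). -/

/-- After a stopped base search without factor (stages 1 and 3, `M = 4^e`): every prime factor of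
`X` exceeds `4^e`, or is `X` itself. [folklore] -/
theorem sf_stage_primes {X e B : ℕ} (hXodd : Odd X) (hX1 : 1 < X) (hcop : ∀ a, 2 ≤ a → a ≤ B + 1 → Nat.Coprime a X)
    (hstop : (sfRun X e (2 ^ e) (2 ^ e * 2 ^ e) B).2.2 ≠ none) (hnofac : sfFac (sfRun X e (2 ^ e) (2 ^ e * 2 ^ e) B) = none) :
    ∀ q, q.Prime → q ∣ X → q ≠ X → 2 ^ e * 2 ^ e < q := by
  set st := sfRun X e (2 ^ e) (2 ^ e * 2 ^ e) B with hst
  obtain ⟨-, -, -, -, hclear, hclass, hcode, -⟩ := sfRun_spec (e := e) (LB := 2 ^ e) (M := 2 ^ e * 2 ^ e) hXodd hX1 Nat.one_le_two_pow hcop B le_rfl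
  rw [← hst] at hclear hclass hcode
  obtain ⟨out, hout⟩ : ∃ out, st.2.2 = some out := by
    rcases hq : st.2.2 with _ | out
    · exact absurd hq hstop
    · exact ⟨out, rfl⟩
  have hfac : out.fac = none := by simp only [sfFac, hout] at hnofac; exact hnofac
  intro q hq hqX hqne
  rcases hcode out hout with ⟨-, h⟩ | ⟨hc, -⟩ | ⟨hc, -⟩
  · exact absurd hfac h
  · -- clear order search at `α = st.1`: `ord_q(α) > 4^e`, so `q - 1 > 4^e` by Fermat
    have hα2 : 2 ≤ st.1 := sfRun_stop_facts X e _ _ B out hout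
    have hαB : st.1 ≤ 1 + B := sfRun_fst X e _ _ B
    have hcopα : Nat.Coprime st.1 X := hcop st.1 hα2 (by omega)
    haveI : Fact q.Prime := ⟨hq⟩
    have hne0 : ((st.1 : ℕ) : ZMod q) ≠ 0 := by
      rw [ne_eq, ZMod.natCast_eq_zero_iff]
      intro hqa
      have := Nat.le_of_dvd Nat.one_pos (hcopα ▸ Nat.dvd_gcd hqa hqX)
      exact absurd hq.one_lt (by omega)
    have hF := ZMod.pow_card_sub_one_eq_one hne0
    by_contra hle
    exact hclear out hout hc q hq hqX (q - 1) (by have := hq.two_le; omega) (by omega) hF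
  · by_contra hle
    exact hqne (hclass out hout hc q hq hqX (by omega))

/-- A number `> 1`, not prime, whose prime factors other than itself exceed `M` with `X < M³… ≤`:
it is a product of two primes `p ≤ q`. [folklore] -/
theorem eq_two_primes {X M : ℕ} (hX1 : 1 < X) (hnp : ¬ X.Prime) (hall : ∀ q, q.Prime → q ∣ X → q ≠ X → M < q)
    (hM : X < (M + 1) * (M + 1) * (M + 1)) : ∃ p q, p.Prime ∧ q.Prime ∧ p ≤ q ∧ X = p * q := by
  have hX0 : 0 < X := by omega
  set p := X.minFac with hp0
  have hp : p.Prime := Nat.minFac_prime (by omega)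
  have hpX : p ∣ X := Nat.minFac_dvd X
  have hpne : p ≠ X := fun he => hnp (he ▸ hp)
  have hMp : M < p := hall p hp hpX hpne
  obtain ⟨Y, hY⟩ : p ∣ X := hpX
  have hY1 : Y ≠ 1 := fun h1 => hpne (by rw [hY, h1, mul_one])
  have hY0 : 0 < Y := Nat.pos_of_ne_zero fun h0 => by rw [hY, h0, mul_zero] at hX0; exact lt_irrefl 0 hX0
  set q := Y.minFac with hq0
  have hq : q.Prime := Nat.minFac_prime hY1
  have hqY : q ∣ Y := Nat.minFac_dvd Y
  have hqX : q ∣ X := hqY.trans ⟨p, by rw [hY, mul_comm]⟩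
  have hqne : q ≠ X := by
    intro he
    have h1 : q ≤ Y := Nat.le_of_dvd hY0 hqY
    have h2 : Y < X := by rw [hY]; nlinarith [hp.two_le]
    omega
  have hMq : M < q := hall q hq hqX hqne
  obtain ⟨Z, hZ⟩ : q ∣ Y := hqY
  have hZ1 : Z = 1 := by
    by_contra hZ1
    have hZ0 : 0 < Z := Nat.pos_of_ne_zero fun h0 => by rw [hZ, h0, mul_zero] at hY0; exact lt_irrefl 0 hY0
    obtain ⟨r, hr, hrZ⟩ := Nat.exists_prime_and_dvd hZ1
    have hrX : r ∣ X := hrZ.trans ⟨p * q, by rw [hY, hZ]; ring⟩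
    have hrne : r ≠ X := by
      intro he
      have h1 : r ≤ Z := Nat.le_of_dvd hZ0 hrZ
      have h2 : Z < X := by rw [hY, hZ]; nlinarith [hp.two_le, hq.two_le]
      omega
    have hMr : M < r := hall r hr hrX hrne
    have hrle : r ≤ Z := Nat.le_of_dvd hZ0 hrZ
    have : (M + 1) * (M + 1) * (M + 1) ≤ X := by
      rw [hY, hZ]
      calc (M + 1) * (M + 1) * (M + 1) ≤ p * q * r := by
            apply Nat.mul_le_mul (Nat.mul_le_mul hMp hMq) hMr
        _ ≤ p * (q * Z) := by rw [mul_assoc]; exact Nat.mul_le_mul_left _ (Nat.mul_le_mul_left _ hrle)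
    omega
  -- `X = p * q` with `p ≤ q` (`p` is the least prime factor)
  refine ⟨p, q, hp, hq, ?_, by rw [hY, hZ, hZ1, mul_one]⟩
  exact Nat.minFac_le_of_dvd hq.two_le hqX

/-- **Completeness of the per-number procedure**: on a good `X`, when none of the three base
searches exhausts its bases, "no factor reported" means `X` is prime.
[cite: Harvey2021, arXiv v3 p.10, proof of Thm. 1 (Prop. 2 + Prop. 16)] -/
theorem coreOut_complete {X B n S : ℕ} (hG : GoodX n B X) (hΩ : X.primeFactorsList.length ≤ 4)
    (hne : ∀ e LB M, 1 ≤ LB → LB ^ X.primeFactors.card < S → (sfRun X e LB M B).2.2 ≠ none)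
    (hS1 : (2 ^ cE1 (encodeNat X).length) ^ 4 < S) (hS3 : (2 ^ cE2 (encodeNat X).length) ^ 2 < S) (hS4 : (2 ^ cL3 (encodeNat X).length) ^ 2 < S)
    (hnone : coreOut X B = none) : X.Prime := by
  have hcard4 : X.primeFactors.card ≤ 4 := by rw [← Nat.toFinset_factors]; exact (List.toFinset_card_le _).trans hΩ
  have hne1 := hne (cE1 (encodeNat X).length) (2 ^ cE1 (encodeNat X).length) (2 ^ cE1 (encodeNat X).length * 2 ^ cE1 (encodeNat X).length) Nat.one_le_two_pow
    (lt_of_le_of_lt (Nat.pow_le_pow_right Nat.one_le_two_pow hcard4) hS1)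
  obtain ⟨hXodd, hX1, -, hnX, -, hcop⟩ := hG
  set nX := (encodeNat X).length with hnX0
  have hXlt : X < 2 ^ nX := by rw [hnX0, TM2Pass.length_encodeNat_eq_size]; exact Nat.lt_size_self X
  simp only [coreOut, Option.or_eq_none_iff] at hnone
  obtain ⟨⟨⟨h1, h2⟩, h3⟩, h45⟩ := hnone
  by_contra hnp
  -- stage 1: at most two prime factors
  have hall1 := sf_stage_primes hXodd hX1 hcop hne1 h1
  set M1 := 2 ^ cE1 nX * 2 ^ cE1 nX with hM1
  have hM1X : X < (M1 + 1) * (M1 + 1) * (M1 + 1) := by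
    have h6 : 2 ^ nX ≤ M1 * M1 * M1 := by
      rw [hM1, ← pow_add, ← pow_add, ← pow_add]; apply Nat.pow_le_pow_right (by omega); simp only [cE1]; omega
    nlinarith
  obtain ⟨p, q, hp, hq, hpq, hXpq⟩ := eq_two_primes hX1 hnp hall1 hM1X
  have hp2 := hp.two_le
  have hq2 := hq.two_le
  have hcard2 : X.primeFactors.card ≤ 2 := by
    rw [hXpq, Nat.primeFactors_mul (by omega) (by omega), hp.primeFactors, hq.primeFactors]
    exact (Finset.card_union_le _ _).trans (by simp)
  have hne3 := hne (cE2 nX) (2 ^ cE2 nX) (2 ^ cE2 nX * 2 ^ cE2 nX) Nat.one_le_two_pow (lt_of_le_of_lt (Nat.pow_le_pow_right Nat.one_le_two_pow hcard2) hS3)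
  have hne4 : (stage4St X B).2.2 ≠ none := by
    rw [stage4St]; exact hne (cE3 nX) (2 ^ cL3 nX) (Nat.sqrt X) Nat.one_le_two_pow (lt_of_le_of_lt (Nat.pow_le_pow_right Nat.one_le_two_pow hcard2) hS4)
  -- stage 2: not a square, so `p < q`
  have hpq' : p < q := by
    refine lt_of_le_of_ne hpq fun he => ?_
    simp only [sqFac] at h2; split_ifs at h2 with hs
    exact hs (by rw [hXpq, ← he, Nat.sqrt_eq])
  have hpX : p ∣ X := ⟨q, hXpq⟩
  have hpne : p ≠ X := by intro he; rw [he] at hXpq; nlinarith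
  have hplt : p < X := lt_of_le_of_ne (Nat.le_of_dvd (by omega) hpX) hpne
  -- stage 3: `p > 4^{e₂}`
  have hall3 := sf_stage_primes hXodd hX1 hcop hne3 h3
  have hp3 : 2 ^ cE2 nX * 2 ^ cE2 nX < p := hall3 p hp hpX hpne
  -- stages 4–5
  simp only [stage45Out, Option.or_eq_none_iff] at h45
  obtain ⟨h4, h5⟩ := h45
  set st := stage4St X B with hst0
  have hst : st = sfRun X (cE3 nX) (2 ^ cL3 nX) (Nat.sqrt X) B := by rw [hst0, stage4St]
  obtain ⟨-, -, -, -, hclear, hclass, hcode, -⟩ := sfRun_spec (e := cE3 nX) (LB := 2 ^ cL3 nX) (M := Nat.sqrt X) hXodd hX1 Nat.one_le_two_pow hcop B le_rfl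
  rw [← hst] at hclear hclass hcode
  obtain ⟨out, hout⟩ : ∃ out, st.2.2 = some out := by
    rcases hq' : st.2.2 with _ | out
    · exact absurd hq' hne4
    · exact ⟨out, rfl⟩
  have hfac : out.fac = none := by simp only [sfFac, hout] at h4; exact h4
  rcases hcode out hout with ⟨-, h⟩ | ⟨hc, -⟩ | ⟨hc, -⟩
  · exact absurd hfac h
  · -- clear order search, then Algorithm 2 must have found the factorisation
    have hcode2 : sfCode st = 2 := by simp only [sfCode, hout, hc]
    rw [if_pos hcode2] at h5
    set m := 2 ^ cER nX with hm0
    have hm : m ≤ 2 ^ cE3 nX * 2 ^ cE3 nX := by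
      rw [hm0, ← pow_add]; apply Nat.pow_le_pow_right (by omega); simp only [cER, cE3]; omega
    have hα2 : 2 ≤ st.1 := sfRun_stop_facts X _ _ _ B out hout
    have hαB : st.1 ≤ 1 + B := by rw [hst]; exact sfRun_fst X _ _ _ B
    have hcopα : Nat.Coprime st.1 X := hcop st.1 hα2 (by omega)
    have hordp : ∀ i, 1 ≤ i → i < m → ((st.1 : ℕ) : ZMod p) ^ i ≠ 1 := fun i hi1 him =>
      hclear out hout hc p hp hpX i hi1 (by omega)
    have hrp : m < p := by
      refine lt_of_le_of_lt ?_ hp3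
      rw [hm0, ← pow_add]; apply Nat.pow_le_pow_right (by omega); simp only [cER, cE2]; omega
    have hlow : X ≤ m * (p * p) := by
      have h1 : 2 ^ nX ≤ m * (2 ^ cE2 nX * 2 ^ cE2 nX * (2 ^ cE2 nX * 2 ^ cE2 nX)) := by
        rw [hm0, ← pow_add, ← pow_add, ← pow_add]; apply Nat.pow_le_pow_right (by omega); simp only [cER, cE2]; omega
      have h2 : 2 ^ cE2 nX * 2 ^ cE2 nX * (2 ^ cE2 nX * 2 ^ cE2 nX) ≤ p * p := Nat.mul_le_mul hp3.le hp3.le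
      have := Nat.mul_le_mul_left m h2
      omega
    exact a2Out_complete hp hq hpq' hXpq hXodd Nat.one_le_two_pow hrp Nat.one_le_two_pow hlow hcopα hordp h5
  · -- code 3 with `M = ⌊√X⌋ ≥ p`: impossible
    have hpM : p ≤ Nat.sqrt X := by rw [Nat.le_sqrt, hXpq]; exact Nat.mul_le_mul_left p hpq
    exact hpne (hclass out hout hc p hp hpX hpM)

end CoreCompleteness


section Exhaustion

/-! ### The base searches never exhaust their bases (above the threshold)

If a base search on `X` with `B = 2^b` bases ran out of bases, every `a ≤ B + 1` would satisfy
`a^L = 1 (mod X)` for its final `L ≤ LB`; the products of `u` distinct primes `≤ B` in `m`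
blocks (`u·m ≤ π(B)`, `B^u < X`) are `m^u` distinct such roots, while `ℤ/X` (odd, `ω` prime
factors) has at most `L^ω ≤ LB^ω` of them (`HarveyTorsionSupply`).  With `b = 4|enc |enc N|| + 8`
and `u = ⌊(|enc X| - 2)/b⌋` this exceeds `LB^ω` for the three searches of the per-number
procedure.  [cite: Harvey2021, arXiv v3 Lemma 9 and the proof of Prop. 14 (the choice of the bases)] -/

/-- **An exhausted base search gives `(π(B)/u)^u ≤ LB^ω`.** [folklore] -/
theorem sf_exhaust_bound {X e LB M b u : ℕ} (hXodd : Odd X) (hX1 : 1 < X) (hLB : 1 ≤ LB) (hcop : ∀ a, 2 ≤ a → a ≤ 2 ^ b + 1 → Nat.Coprime a X)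
    (hBu : (2 ^ b) ^ u < X) (hex : (sfRun X e LB M (2 ^ b)).2.2 = none) :
    (Nat.primeCounting (2 ^ b) / u) ^ u ≤ LB ^ X.primeFactors.card := by
  haveI : NeZero X := ⟨by omega⟩
  obtain ⟨-, hL1, -, -, -, -, -, hnone⟩ := sfRun_spec (e := e) (LB := LB) (M := M) hXodd hX1 hLB hcop (2 ^ b) le_rfl
  obtain ⟨hLle, hall⟩ := hnone hex
  set L := (sfRun X e LB M (2 ^ b)).2.1 with hL
  have h1 := HarveyNT.le_card_pow_eq_one (N := X) (B := 2 ^ b) (u := u) (m := Nat.primeCounting (2 ^ b) / u) (L := L)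
    (by rw [mul_comm]; exact Nat.div_mul_le_self _ _) hBu (fun a ha2 haB => hall a ha2 (by omega))
  have h2 := HarveyNT.powOneCount_le L hL1 X hXodd
  unfold HarveyNT.powOneCount at h2
  exact (h1.trans h2).trans (Nat.pow_le_pow_left hLle _)

/-- **The supply of short primes**: `π(2^b)/u ≥ 2^{3L₀+6}` when `b = 4L₀ + 8` and `b·u < 2^{L₀}`. [folklore] -/
theorem supply_lower {L0 u : ℕ} (hbu : (4 * L0 + 8) * u < 2 ^ L0) (hu : 1 ≤ u) : 2 ^ (3 * L0 + 6) ≤ Nat.primeCounting (2 ^ (4 * L0 + 8)) / u := by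
  set b := 4 * L0 + 8 with hb
  rw [Nat.le_div_iff_mul_le (by omega)]
  have hC := two_pow_le_mul_primeCounting b
  -- `b · π(2^b) ≥ 2^b - b - 1 ≥ 2^{b-2} > 2^{3L₀+6} · (b u)`
  have h1 : 2 ^ (3 * L0 + 6) * (b * u) < 2 ^ (b - 2) := by
    calc 2 ^ (3 * L0 + 6) * (b * u) < 2 ^ (3 * L0 + 6) * 2 ^ L0 := Nat.mul_lt_mul_of_pos_left hbu (by positivity)
      _ = 2 ^ (b - 2) := by rw [← pow_add]; congr 1; omega
  have h2 : 2 ^ (b - 2) ≤ b * Nat.primeCounting (2 ^ b) := by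
    have h4 : 2 ^ b = 2 ^ (b - 2) * 4 := by rw [show (4 : ℕ) = 2 ^ 2 by norm_num, ← pow_add]; congr 1
    have hb1 : b + 1 ≤ 2 ^ (b - 2) := by
      have : ∀ k, (k + 8) + 1 ≤ 2 ^ (k + 8 - 2) := fun k => by
        induction k with
        | zero => norm_num
        | succ k ih => rw [show k + 1 + 8 - 2 = (k + 8 - 2) + 1 by omega, pow_succ]; omega
      have := this (b - 8); rwa [show b - 8 + 8 = b by omega] at this
    omega
  have h3 : b * (2 ^ (3 * L0 + 6) * u) < b * Nat.primeCounting (2 ^ b) := by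
    calc b * (2 ^ (3 * L0 + 6) * u) = 2 ^ (3 * L0 + 6) * (b * u) := by ring
      _ < _ := lt_of_lt_of_le h1 h2
  exact (Nat.lt_of_mul_lt_mul_left h3).le

/-- A list of numbers `≥ c` has product `≥ c^{length}`. [folklore] -/
private theorem pow_length_le_prod {c : ℕ} : ∀ (l : List ℕ), (∀ x ∈ l, c ≤ x) → c ^ l.length ≤ l.prod
  | [], _ => by simp
  | x :: l, hl => by
    rw [List.length_cons, pow_succ, List.prod_cons, mul_comm]
    exact Nat.mul_le_mul (hl x (by simp)) (pow_length_le_prod l fun y hy => hl y (List.mem_cons_of_mem _ hy))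

/-- Divisors of the cofactor have at most four prime factors (above the threshold). [folklore] -/
theorem omega_le_four {N X : ℕ} (hN : 1 ≤ N) (hreg : n₀ ≤ (encodeNat N).length) (hX1 : 1 ≤ X) (hXd : X ∣ (tdOf N).1) : X.primeFactorsList.length ≤ 4 := by
  obtain ⟨hf1, hfN, hfp, -⟩ := tdOf_facts hN
  set nN := (encodeNat N).length with hnN
  have hNlt : N < 2 ^ nN := by rw [hnN, TM2Pass.length_encodeNat_eq_size]; exact Nat.lt_size_self N
  have hXN : X ≤ N := (Nat.le_of_dvd (by omega) hXd).trans hfN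
  have hall : ∀ x ∈ X.primeFactorsList, 2 ^ tE nN ≤ x := fun x hx =>
    le_of_lt (lt_of_lt_of_le (by omega) (hfp x (Nat.prime_of_mem_primeFactorsList hx) ((Nat.dvd_of_mem_primeFactorsList hx).trans hXd)))
  have h1 := pow_length_le_prod _ hall
  rw [Nat.prod_primeFactorsList (by omega), ← pow_mul] at h1
  have h2 : tE nN * X.primeFactorsList.length < nN := (Nat.pow_lt_pow_iff_right (by omega)).1 (lt_of_le_of_lt h1 (lt_of_le_of_lt hXN hNlt))
  by_contra h5
  have : tE nN * 5 ≤ tE nN * X.primeFactorsList.length := Nat.mul_le_mul_left _ (by omega)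
  simp only [tE, if_pos hreg] at h2 this; omega

/-- **No exhaustion, and the three supply inequalities**, for divisors `> 1` of the cofactor above the threshold. [folklore] -/
theorem supply_facts {N X : ℕ} (hN : 1 ≤ N) (hreg : n₀ ≤ (encodeNat N).length) (hX1 : 1 < X) (hXd : X ∣ (tdOf N).1) :
    let nX := (encodeNat X).length
    let u := (nX - 2) / bE (encodeNat N).length
    let S := (Nat.primeCounting (bOf N) / u) ^ u
    (∀ e LB M, 1 ≤ LB → LB ^ X.primeFactors.card < S → (sfRun X e LB M (bOf N)).2.2 ≠ none) ∧
    (2 ^ cE1 nX) ^ 4 < S ∧ (2 ^ cE2 nX) ^ 2 < S ∧ (2 ^ cL3 nX) ^ 2 < S := by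
  intro nX u S
  obtain ⟨h13, hbig, hnNlt⟩ := regime_len hreg
  obtain ⟨hf1, hfN, hfp, -⟩ := tdOf_facts hN
  obtain ⟨hXodd, -, -, -, -, hcop⟩ := goodX_of_dvd hN hX1 hXd
  set nN := (encodeNat N).length with hnN
  set L0 := (encodeNat nN).length with hL0
  have hXN : X ≤ N := (Nat.le_of_dvd (by omega) hXd).trans hfN
  have hnXN : nX ≤ nN := Brick.length_encodeNat_mono hXN
  -- `nX ≥ tE + 1`
  obtain ⟨p₀, hp₀, hp₀X⟩ := Nat.exists_prime_and_dvd (show X ≠ 1 by omega)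
  have hXge : 2 ^ tE nN ≤ X := by
    have := hfp p₀ hp₀ (hp₀X.trans hXd); have := Nat.le_of_dvd (by omega) hp₀X; omega
  have hnXge : tE nN + 1 ≤ nX := by
    show tE nN < (encodeNat X).length; rw [TM2Pass.length_encodeNat_eq_size]; exact Nat.lt_size.2 hXge
  have htE : tE nN = (nN + 4) / 5 + 1 := by simp only [tE, if_pos hreg]
  have hbE : bE nN = 4 * L0 + 8 := by simp only [bE, hL0]; ring
  -- the floor `u`
  have hu0 : u = (nX - 2) / (4 * L0 + 8) := by show (nX - 2) / bE nN = _; rw [hbE]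
  have hbu : (4 * L0 + 8) * u ≤ nX - 2 := by rw [hu0]; exact Nat.mul_div_le _ _
  have hbu' : nX - 2 < (4 * L0 + 8) * (u + 1) := by rw [hu0]; exact Nat.lt_mul_div_succ _ (by omega)
  have hu1 : 1 ≤ u := by
    rw [hu0, Nat.le_div_iff_mul_le (by omega)]; omega
  have hbu2 : (4 * L0 + 8) * u < 2 ^ L0 := by omega
  -- the supply
  have hm := supply_lower hbu2 hu1
  have hS : 2 ^ ((3 * L0 + 6) * u) ≤ S := by
    show 2 ^ ((3 * L0 + 6) * u) ≤ (Nat.primeCounting (bOf N) / u) ^ u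
    rw [pow_mul, show bOf N = 2 ^ (4 * L0 + 8) by rw [← hbE, hnN]; rfl]; exact Nat.pow_le_pow_left hm u
  set W := (L0 + 2) * u with hW
  have hW4 : nX - 2 < 4 * W + (4 * L0 + 8) := by rw [hW]; nlinarith
  have h36 : 36 * L0 + 122 ≤ nX := by omega
  have hlt : ∀ k, k < 3 * W → 2 ^ k < S := fun k hk =>
    lt_of_lt_of_le (Nat.pow_lt_pow_right (by omega) (by rw [hW] at hk; nlinarith)) hS
  have hp : ∀ a k, a * k < 3 * W → (2 ^ a) ^ k < S := fun a k hk => by rw [← pow_mul]; exact hlt _ hk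
  refine ⟨fun e LB M hLB hLS hex => ?_, hp _ _ ?_, hp _ _ ?_, hp _ _ ?_⟩
  · -- exhaustion contradicts the supply
    have hBu : (2 ^ bE nN) ^ u < X := by
      rw [← pow_mul]
      refine lt_of_lt_of_le (Nat.pow_lt_pow_right (by omega) (show bE nN * u < nX - 1 by rw [hbE]; omega)) ?_
      show 2 ^ ((encodeNat X).length - 1) ≤ X
      rw [TM2Pass.length_encodeNat_eq_size]; exact Nat.lt_size.1 (by rw [← TM2Pass.length_encodeNat_eq_size]; omega)
    have hBo : bOf N = 2 ^ bE nN := by rw [hnN]; rfl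
    have hcop' : ∀ a, 2 ≤ a → a ≤ 2 ^ bE nN + 1 → Nat.Coprime a X := fun a h1 h2 => hcop a h1 (by rw [hBo]; exact h2)
    have hb := sf_exhaust_bound (e := e) (LB := LB) (M := M) hXodd hX1 hLB hcop' hBu (by rw [hBo] at hex; exact hex)
    have hLS' : LB ^ X.primeFactors.card < (Nat.primeCounting (2 ^ bE nN) / u) ^ u := by rw [← hBo]; exact hLS
    exact absurd (lt_of_lt_of_le hLS' hb) (lt_irrefl _)
  · simp only [cE1]; omega
  · simp only [cE2]; omega
  · simp only [cL3]; omega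

/-- **"No factor" means prime**, for divisors `> 1` of the cofactor. [folklore] -/
theorem core_prime_of_none {N X : ℕ} (hN : 1 ≤ N) (hX1 : 1 < X) (hXd : X ∣ (tdOf N).1) (hnone : coreOut X (bOf N) = none) : X.Prime := by
  by_cases hreg : n₀ ≤ (encodeNat N).length
  · obtain ⟨hne, hS1, hS3, hS4⟩ := supply_facts hN hreg hX1 hXd
    exact coreOut_complete (goodX_of_dvd hN hX1 hXd) (omega_le_four hN hreg (by omega) hXd) hne hS1 hS3 hS4 hnone
  · exfalso
    have := Nat.le_of_dvd (by have := (tdOf_facts hN).1; omega) hXd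
    rw [tdOf_fst_eq_one hN hreg] at this; omega

end Exhaustion


section OutputCorrect

/-! ### The output is the prime factorisation

The potential `Σ (2Ω(X) - 1)` over the work stack drops by one per round (a prime leaves, a split
`X = g · X/g` keeps `Ω`); it starts `≤ 7` (`Ω ≤ 4`), so after seven rounds the stack is empty, the
reported primes multiply to the cofactor, and the output — the primes of trial division followed by
the sorted primes of the rounds — is the sorted list of the prime factors of `N` with multiplicity.
[cite: Harvey2021, arXiv v3 p.10, proof of Thm. 1] -/

/-- The potential of the work stack. [folklore] -/
def phi (l : List ℕ) : ℕ := (l.map fun X => 2 * X.primeFactorsList.length - 1).sum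

/-- `Ω ≥ 1` above `1`. [folklore] -/
theorem one_le_omega {X : ℕ} (hX : 1 < X) : 1 ≤ X.primeFactorsList.length := by
  rcases Nat.eq_zero_or_pos X.primeFactorsList.length with h0 | h0
  · rw [List.length_eq_zero_iff, Nat.primeFactorsList_eq_nil] at h0; omega
  · exact h0

/-- `Ω` is additive. [folklore] -/
theorem omega_mul {a b : ℕ} (ha : a ≠ 0) (hb : b ≠ 0) : (a * b).primeFactorsList.length = a.primeFactorsList.length + b.primeFactorsList.length := by
  rw [(Nat.perm_primeFactorsList_mul ha hb).length_eq, List.length_append]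

/-- Rounds on an empty stack. [folklore] -/
theorem roundsRun_nil (B : ℕ) (ps : List ℕ) : ∀ k, roundsRun B ([], ps) k = ([], ps)
  | 0 => rfl
  | k + 1 => by rw [roundsRun, roundsRun_nil B ps k]

/-- **The invariant of the rounds, II**: the product, the primes, the potential. [folklore] -/
theorem roundsRun_full {N : ℕ} (hN : 1 ≤ N) : ∀ k,
    (tdOf N).1 = (roundsRun (bOf N) (stack0 (tdOf N).1, []) k).1.prod * (roundsRun (bOf N) (stack0 (tdOf N).1, []) k).2.prod ∧
    (∀ p ∈ (roundsRun (bOf N) (stack0 (tdOf N).1, []) k).2, p.Prime) ∧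
    ((roundsRun (bOf N) (stack0 (tdOf N).1, []) k).1 = [] ∨ phi (roundsRun (bOf N) (stack0 (tdOf N).1, []) k).1 + k ≤ phi (stack0 (tdOf N).1))
  | 0 => by
    refine ⟨?_, by simp [roundsRun], Or.inr (by simp [roundsRun])⟩
    simp only [roundsRun, stack0]; split_ifs with h1
    · have := (tdOf_facts hN).1; simp; omega
    · simp
  | k + 1 => by
    obtain ⟨ih1, ih2, ih3⟩ := roundsRun_full hN k
    have hgood : ∀ X, 1 < X → X ∣ (tdOf N).1 → GoodX (nPar N) (bOf N) X := fun X => goodX_of_dvd hN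
    have hinv := (roundsRun_inv hgood k).1
    rw [roundsRun]
    rcases hs : roundsRun (bOf N) (stack0 (tdOf N).1, []) k with ⟨stk, ps⟩
    rw [hs] at ih1 ih2 ih3 hinv
    cases stk with
    | nil => exact ⟨ih1, ih2, Or.inl rfl⟩
    | cons X rest =>
      obtain ⟨hX1, hXd⟩ := hinv X (by simp)
      have hph : phi (X :: rest) = (2 * X.primeFactorsList.length - 1) + phi rest := by simp [phi]
      rcases ih3 with h | h
      · exact absurd h (by simp)
      simp only [roundStep]
      rcases hq : coreOut X (bOf N) with _ | g
      · -- `X` is prime and leaves the stack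
        have hXp : X.Prime := core_prime_of_none hN hX1 hXd hq
        refine ⟨by rw [ih1]; simp [List.prod_cons]; ring, fun p hp => ?_, Or.inr ?_⟩
        · rcases List.mem_cons.1 hp with rfl | hp
          · exact hXp
          · exact ih2 p hp
        · have : X.primeFactorsList.length = 1 := by rw [Nat.primeFactorsList_prime hXp]; rfl
          simp only at h ⊢; rw [hph, this] at h; omega
      · -- a split `X = g · X/g`
        obtain ⟨hg1, hgX, hgd⟩ := coreOut_sound (hgood X hX1 hXd) hq
        have hXg : g * (X / g) = X := Nat.mul_div_cancel' hgd
        have hq1 : 1 < X / g := by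
          by_contra hle; push Not at hle
          have : g * (X / g) ≤ g * 1 := Nat.mul_le_mul_left g hle
          omega
        refine ⟨by rw [ih1]; simp only [List.prod_cons]; rw [← mul_assoc, hXg], ih2, Or.inr ?_⟩
        have hΩ : X.primeFactorsList.length = g.primeFactorsList.length + (X / g).primeFactorsList.length := by
          rw [← omega_mul (by omega) (by omega), hXg]
        have h1 := one_le_omega hg1
        have h2 := one_le_omega hq1
        have hph' : phi (g :: X / g :: rest) = (2 * g.primeFactorsList.length - 1) + ((2 * (X / g).primeFactorsList.length - 1) + phi rest) := by simp [phi]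
        simp only at h ⊢; rw [hph'] ; rw [hph, hΩ] at h; omega

/-- **After seven rounds the work stack is empty.** [folklore] -/
theorem roundsOf_fst_nil {N : ℕ} (hN : 1 ≤ N) : (roundsOf N).1 = [] := by
  obtain ⟨-, -, h3⟩ := roundsRun_full hN 7
  rw [roundsOf]
  rcases h3 with h | h
  · exact h
  · -- the potential starts `≤ 7` and an element contributes `≥ 1`
    have hgood : ∀ X, 1 < X → X ∣ (tdOf N).1 → GoodX (nPar N) (bOf N) X := fun X => goodX_of_dvd hN
    have hinv := (roundsRun_inv hgood 7).1
    have h0 : phi (stack0 (tdOf N).1) ≤ 7 := by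
      simp only [stack0]; split_ifs with h1
      · simp [phi]
      · by_cases hreg : n₀ ≤ (encodeNat N).length
        · have := omega_le_four hN hreg (le_refl _ |>.trans (by omega)) dvd_rfl
          simp [phi]; omega
        · rw [tdOf_fst_eq_one hN hreg] at h1; omega
    rcases hq : (roundsRun (bOf N) (stack0 (tdOf N).1, []) 7).1 with _ | ⟨Y, rest⟩
    · rfl
    · exfalso
      rw [hq] at h hinv
      have hY := one_le_omega (hinv Y (by simp)).1
      have : phi (Y :: rest) = (2 * Y.primeFactorsList.length - 1) + phi rest := by simp [phi]
      omega

/-- Trial division with no rounds. [folklore] -/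
theorem tdRun_zero_rounds (N : ℕ) : ∀ j, tdRun N 0 j = (N, [])
  | 0 => rfl
  | j + 1 => by rw [tdRun, tdRun_zero_rounds N j]; rfl

/-- The sorted keys of the prime words are a sorted permutation of the primes. [folklore] -/
theorem sortedKeys_facts {nb : ℕ} {ps : List ℕ} (hps : ∀ p ∈ ps, (encodeNat p).length ≤ nb) :
    (sortedKeys nb ps).Perm ps ∧ (sortedKeys nb ps).Pairwise (· ≤ ·) := by
  constructor
  · unfold sortedKeys
    have h1 := (radixIter_perm (primeWords nb ps) nb).map fun w => keyOf nb w
    refine h1.trans ?_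
    rw [primeWords, List.map_map]
    have : List.map ((fun w => keyOf nb w) ∘ fun p => mkWord nb p false []) ps = ps := by
      conv_rhs => rw [← List.map_id ps]
      refine List.map_congr_left fun p hp => ?_
      simp only [Function.comp_apply, id_eq]; exact keyOf_mkWord (hps p hp) false []
    rw [this]
  · unfold sortedKeys
    rw [List.pairwise_map]
    exact sorted_radixIter (primeWords nb ps) nb

/-- **The output of the factoring machine is the prime factorisation** (sorted, with multiplicity).
[cite: Harvey2021, Thm. 1.1 / arXiv v3 Thm. 1, proof on p.10] -/
theorem factorOut_eq (N : ℕ) : factorOut N = Nat.primeFactorsList N := by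
  rcases Nat.eq_zero_or_pos N with rfl | hN
  · have h0 : tdOf 0 = (0, []) := by rw [tdOf, show (encodeNat 0).length = 0 by rfl, tdRun_zero_rounds]
    have h1 : roundsOf 0 = ([], []) := by rw [roundsOf, h0]; simp only [stack0]; exact roundsRun_nil _ _ 7
    have h2 : ∀ k, sortedKeys k ([] : List ℕ) = [] := fun k => List.eq_nil_of_length_eq_zero (by simp [sortedKeys, length_radixIter, primeWords])
    rw [factorOut, h0, h1, h2, Nat.primeFactorsList_zero]; rfl
  · obtain ⟨hf1, hfN, hfp, hsmall, hsort, hprod⟩ := tdOf_facts hN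
    obtain ⟨hP, hprime, -⟩ := roundsRun_full hN 7
    have hnil := roundsOf_fst_nil hN
    rw [roundsOf] at hnil
    rw [hnil, List.prod_nil, one_mul] at hP
    set ps := (roundsRun (bOf N) (stack0 (tdOf N).1, []) 7).2 with hps0
    have hpsR : (roundsOf N).2 = ps := by rw [roundsOf]
    have hgood : ∀ X, 1 < X → X ∣ (tdOf N).1 → GoodX (nPar N) (bOf N) X := fun X => goodX_of_dvd hN
    have hpsd := (roundsRun_inv hgood 7).2
    rw [← hps0] at hpsd
    set nN := (encodeNat N).length with hnN
    have hNlt : N < 2 ^ nN := by rw [hnN, TM2Pass.length_encodeNat_eq_size]; exact Nat.lt_size_self N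
    have hpsl : ∀ p ∈ ps, (encodeNat p).length ≤ nN + 1 := fun p hp => by
      have h1 := (Nat.le_of_dvd (by omega) (hpsd p hp).2).trans hfN
      have := Brick.length_encodeNat_mono h1; omega
    obtain ⟨hperm, hsorted⟩ := sortedKeys_facts hpsl
    rw [factorOut, hpsR, ← hnN]
    apply List.Perm.eq_of_sortedLE
    · refine (List.pairwise_append.2 ⟨hsort, hsorted, fun a ha b hb => ?_⟩).sortedLE
      have h1 := (hsmall a ha).2
      obtain ⟨hb1, hbd⟩ := hpsd b (hperm.subset hb)
      have h2 := hfp b (hprime b (hperm.subset hb)) hbd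
      omega
    · exact Nat.primeFactorsList_sorted N
    · refine Nat.primeFactorsList_unique ?_ fun p hp => ?_
      · rw [List.prod_append, hperm.prod_eq, ← hP, mul_comm]; exact hprod
      · rcases List.mem_append.1 hp with hp | hp
        · exact (hsmall p hp).1
        · exact hprime p (hperm.subset hp)

end OutputCorrect

section CostBoundsA

/-! ### Closed-form bounds on the costs, I: the transforms and Algorithm 1

Every cost of the toolkit is a polynomial in `n` times at most one factor that is a power of two
or a count; this section bounds the costs of the product tree, Bluestein's chirp transform and
Algorithm 1 by `K · unit` for explicit units. -/

/-- The unary-conversion term. [folklore] -/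
theorem toUnaryTerm_le (k c : ℕ) (hc : 1 ≤ c) : (k + 1) * (16 * 2 ^ k + 21) + 5 ≤ 42 * ((k + 1) * 2 ^ k * c) := by
  have h1 : 1 ≤ 2 ^ k := Nat.one_le_two_pow
  have h2 : (k + 1) * (16 * 2 ^ k + 21) + 5 ≤ 42 * ((k + 1) * 2 ^ k) := by nlinarith
  exact h2.trans (Nat.mul_le_mul_left _ (Nat.le_mul_of_pos_right _ hc))

/-- The unary-conversion term of a bounded value. [folklore] -/
theorem toUnaryOf_le {x n : ℕ} (hx : (encodeNat x).length ≤ n) (c : ℕ) (hc : n + 1 ≤ c) : (encodeNat x).length * (16 * x + 21) + 5 ≤ 42 * ((x + 1) * c) := by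
  have := Nat.mul_le_mul_right (16 * x + 21) hx
  nlinarith

/-- The power-of-two term. [folklore] -/
theorem powTerm_le (n k c : ℕ) (hc : n + 1 ≤ c) : n * (16 * k + 21) + 3 * k + 7 ≤ 21 * ((k + 1) * c) := by nlinarith

/-- `1 ≤ (n+1)³` and `n + 1 ≤ (n+1)³`. [folklore] -/
theorem cube_facts (n : ℕ) : 1 ≤ (n + 1) ^ 3 ∧ n + 1 ≤ (n + 1) ^ 3 :=
  ⟨Nat.one_le_pow _ _ (by omega), by
    calc n + 1 = (n + 1) ^ 1 := (pow_one _).symm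
      _ ≤ (n + 1) ^ 3 := Nat.pow_le_pow_right (by omega) (by omega)⟩

/-- The leaf pass. [folklore] -/
theorem leafPassCost_le (n V : ℕ) : leafPassCost n V ≤ 1100 * ((V + 1) * (n + 1) ^ 3) := by
  obtain ⟨h1, h2⟩ := cube_facts n
  unfold leafPassCost
  nlinarith [Nat.mul_le_mul_left V h2, Nat.mul_le_mul_left V h1]

/-- The residue pass. [folklore] -/
theorem a1ResidCost_le (n V : ℕ) : a1ResidCost n V ≤ 1100 * ((V + 1) * (n + 1) ^ 3) := by
  obtain ⟨h1, h2⟩ := cube_facts n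
  unfold a1ResidCost
  nlinarith [Nat.mul_le_mul_left V h2, Nat.mul_le_mul_left V h1]

/-- The value scan. [folklore] -/
theorem a1Scan1Cost_le (n k m : ℕ) : a1Scan1Cost n k m ≤ 1600 * ((m + (k + 1) * 2 ^ k + 1) * (n + 1) ^ 3) := by
  obtain ⟨h1, h2⟩ := cube_facts n
  have h3 : 1 ≤ 2 ^ k := Nat.one_le_two_pow
  unfold a1Scan1Cost
  nlinarith [toUnaryTerm_le k _ h1, Nat.mul_le_mul_left m h1, Nat.mul_le_mul_left (2 ^ k) h2, Nat.mul_le_mul_right (2 ^ k * (n + 1) ^ 3) (show 1 ≤ k + 1 by omega)]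

/-- The `f` pass of Bluestein. [folklore] -/
theorem blFPassCost_le (n k V : ℕ) : blFPassCost n k V ≤ 3900 * ((V + (k + 1) * 2 ^ k) * (n + 1) ^ 3) := by
  obtain ⟨h1, h2⟩ := cube_facts n
  have h3 : 1 ≤ 2 ^ k := Nat.one_le_two_pow
  have hu : (n + 1) ^ 3 ≤ (k + 1) * 2 ^ k * (n + 1) ^ 3 := Nat.le_mul_of_pos_left _ (by positivity)
  unfold blFPassCost
  nlinarith [toUnaryTerm_le k _ h1, powTerm_le n k _ (h2.trans (Nat.le_mul_of_pos_left _ h3)), Nat.mul_le_mul_left V h1, Nat.mul_le_mul_left (2 ^ k) h2, Nat.mul_le_mul_left (2 ^ k) h1,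
    Nat.mul_le_mul_right (2 ^ k * (n + 1) ^ 3) (show 1 ≤ k + 1 by omega)]

/-- The padding of the `g'` block. [folklore] -/
theorem blGPadCost_le (n k : ℕ) : blGPadCost n k ≤ 330 * (((k + 1) * 2 ^ k) * (n + 1) ^ 3) := by
  obtain ⟨h1, h2⟩ := cube_facts n
  have h3 : 1 ≤ 2 ^ k := Nat.one_le_two_pow
  have hu : (n + 1) ^ 3 ≤ (k + 1) * 2 ^ k * (n + 1) ^ 3 := Nat.le_mul_of_pos_left _ (by positivity)
  unfold blGPadCost
  nlinarith [toUnaryTerm_le k _ h1, powTerm_le n k _ (h2.trans (Nat.le_mul_of_pos_left _ h3)), Nat.mul_le_mul_left (2 ^ k) h2, Nat.mul_le_mul_left (2 ^ k) h1,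
    Nat.mul_le_mul_right (2 ^ k * (n + 1) ^ 3) (show 1 ≤ k + 1 by omega)]

/-- The `g'` pass. [folklore] -/
theorem blGPassCost_le (n k : ℕ) : blGPassCost n k ≤ 5000 * (((k + 1) * 2 ^ k) * (n + 1) ^ 3) := by
  obtain ⟨h1, h2⟩ := cube_facts n
  have h3 : 1 ≤ 2 ^ k := Nat.one_le_two_pow
  have hu : (n + 1) ^ 3 ≤ (k + 1) * 2 ^ k * (n + 1) ^ 3 := Nat.le_mul_of_pos_left _ (by positivity)
  unfold blGPassCost
  nlinarith [toUnaryTerm_le k _ h1, blGPadCost_le n k, Nat.mul_le_mul_left (2 ^ k) h1, Nat.mul_le_mul_right (2 ^ k * (n + 1) ^ 3) (show 1 ≤ k + 1 by omega)]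

/-- Reading the product. [folklore] -/
theorem blXSkipCost_le (n k : ℕ) : blXSkipCost n k ≤ 200 * (((k + 1) * 2 ^ k) * (n + 1) ^ 3) := by
  obtain ⟨h1, h2⟩ := cube_facts n
  have h3 : 1 ≤ 2 ^ k := Nat.one_le_two_pow
  have hu : (n + 1) ^ 3 ≤ (k + 1) * 2 ^ k * (n + 1) ^ 3 := Nat.le_mul_of_pos_left _ (by positivity)
  unfold blXSkipCost
  nlinarith [toUnaryTerm_le k _ h1, Nat.mul_le_mul_left (2 ^ k) h2, Nat.mul_le_mul_left (2 ^ k) h1, Nat.mul_le_mul_right (2 ^ k * (n + 1) ^ 3) (show 1 ≤ k + 1 by omega)]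

/-- The value extraction. [folklore] -/
theorem blXValsCost_le (n k : ℕ) : blXValsCost n k ≤ 3900 * (((k + 1) * 2 ^ k) * (n + 1) ^ 3) := by
  obtain ⟨h1, h2⟩ := cube_facts n
  have h3 : 1 ≤ 2 ^ k := Nat.one_le_two_pow
  have hu : (n + 1) ^ 3 ≤ (k + 1) * 2 ^ k * (n + 1) ^ 3 := Nat.le_mul_of_pos_left _ (by positivity)
  unfold blXValsCost
  nlinarith [toUnaryTerm_le k _ h1, Nat.mul_le_mul_left (2 ^ k) h2, Nat.mul_le_mul_left (2 ^ k) h1, Nat.mul_le_mul_right (2 ^ k * (n + 1) ^ 3) (show 1 ≤ k + 1 by omega)]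

/-- **Bluestein's chirp transform** costs `O((V + (k+1)² 2^k) (n+1)³)`. [folklore] -/
theorem bluesteinCost_le (n k V : ℕ) : bluesteinCost n k V ≤ 420000 * ((V + (k + 1) ^ 2 * 2 ^ k) * (n + 1) ^ 3) := by
  obtain ⟨h1, -⟩ := cube_facts n
  have h3 : 1 ≤ 2 ^ k := Nat.one_le_two_pow
  have hu : (n + 1) ^ 3 ≤ (k + 1) * 2 ^ k * (n + 1) ^ 3 := Nat.le_mul_of_pos_left _ (by positivity)
  have h6 : (k + 1) * 2 ^ k * (n + 1) ^ 3 ≤ (k + 1) ^ 2 * 2 ^ k * (n + 1) ^ 3 := Nat.mul_le_mul_right _ (Nat.mul_le_mul_right _ (by nlinarith))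
  have h5 := negMulMachineCost_le n k 1
  unfold bluesteinCost
  nlinarith [blFPassCost_le n k V, blGPassCost_le n k, blXSkipCost_le n k, blXValsCost_le n k]

/-- **The product tree** costs `O((e+3)³ 2^e (n+1)³)`. [folklore] -/
theorem a1TreeCost_le (n e : ℕ) : a1TreeCost n e ≤ 610000 * (((e + 3) ^ 3 * 2 ^ e) * (n + 1) ^ 3) := by
  obtain ⟨h1, h2⟩ := cube_facts n
  have h3 : 1 ≤ 2 ^ e := Nat.one_le_two_pow
  have hu : (n + 1) ^ 3 ≤ (e + 1) * 2 ^ e * (n + 1) ^ 3 := Nat.le_mul_of_pos_left _ (by positivity)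
  have h6 : (e + 1) * 2 ^ e * (n + 1) ^ 3 ≤ (e + 3) ^ 3 * 2 ^ e * (n + 1) ^ 3 := Nat.mul_le_mul_right _ (Nat.mul_le_mul_right _ (le_trans (by omega) (cube_facts (e + 2)).2))
  have hw : 2 ^ e * (n + 1) ^ 3 ≤ (e + 1) * 2 ^ e * (n + 1) ^ 3 := by nlinarith
  have h5 : e * (ptLevelBound n e + 2) ≤ 600000 * ((e + 3) ^ 3 * 2 ^ e * (n + 1) ^ 3) + 2 * e := by
    have : e * ptLevelBound n e ≤ 600000 * ((e + 3) ^ 3 * 2 ^ e * (n + 1) ^ 3) := by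
      unfold ptLevelBound; rw [pow_succ]
      calc e * (300000 * ((e + 3) ^ 2 * (2 ^ e * 2 * (n + 1) ^ 3))) = 600000 * (e * (e + 3) ^ 2 * 2 ^ e * (n + 1) ^ 3) := by ring
        _ ≤ 600000 * ((e + 3) ^ 3 * 2 ^ e * (n + 1) ^ 3) := by
          apply Nat.mul_le_mul_left; apply Nat.mul_le_mul_right; apply Nat.mul_le_mul_right; rw [pow_succ, mul_comm]; exact Nat.mul_le_mul_left _ (by omega)
    nlinarith
  have h7 : e ≤ (e + 1) * 2 ^ e * (n + 1) ^ 3 := le_trans (Nat.le_succ e) (by rw [mul_assoc]; exact Nat.le_mul_of_pos_right _ (by positivity))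
  unfold a1TreeCost
  nlinarith [toUnaryTerm_le e _ h1, powTerm_le n e _ (h2.trans (Nat.le_mul_of_pos_left _ h3)), leafPassCost_le n (2 ^ e), Nat.mul_le_mul_left (2 ^ e) h2, Nat.mul_le_mul_left (2 ^ e) h1]

/-- The coefficients of `f`. [folklore] -/
theorem a1CoefCost_le (n e : ℕ) : a1CoefCost n e ≤ 13000 * (((e + 1) * 2 ^ e) * (n + 1) ^ 3) := by
  obtain ⟨h1, h2⟩ := cube_facts n
  have h3 : 1 ≤ 2 ^ e := Nat.one_le_two_pow
  have hu : (n + 1) ^ 3 ≤ (e + 1) * 2 ^ e * (n + 1) ^ 3 := Nat.le_mul_of_pos_left _ (by positivity)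
  have h4 : 2 ^ (e + 2) = 4 * 2 ^ e := by rw [pow_add]; ring
  have h5 : 2 ^ (e + 1) = 2 * 2 ^ e := by rw [pow_succ]; ring
  have hT := toUnaryTerm_le (e + 1) _ h1
  unfold a1CoefCost
  rw [h4, h5]; rw [h5] at hT
  nlinarith [powTerm_le n e _ (h2.trans (Nat.le_mul_of_pos_left _ h3)), Nat.mul_le_mul_left (2 ^ e) h2, Nat.mul_le_mul_left (2 ^ e) h1]

/-- The second scan. [folklore] -/
theorem a1Scan2Cost_le (n e : ℕ) : a1Scan2Cost n e ≤ 10000 * (((e + 1) * 2 ^ e) * (n + 1) ^ 3) := by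
  obtain ⟨h1, h2⟩ := cube_facts n
  have h3 : 1 ≤ 2 ^ e := Nat.one_le_two_pow
  have hu : (n + 1) ^ 3 ≤ (e + 1) * 2 ^ e * (n + 1) ^ 3 := Nat.le_mul_of_pos_left _ (by positivity)
  have hv : 2 ^ e * (n + 1) ^ 3 ≤ (e + 1) * 2 ^ e * (n + 1) ^ 3 := by nlinarith
  unfold a1Scan2Cost
  nlinarith [powTerm_le n e _ (h2.trans (Nat.le_mul_of_pos_left _ h3)), a1ResidCost_le n (2 ^ e), a1Scan1Cost_le n e (2 ^ e)]

/-- **Algorithm 1** costs `O(((e+3)³ 2^e + (k+1)² 2^k + m) (n+1)³)`. [folklore] -/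
theorem alg1Cost_le (n e k m : ℕ) : alg1Cost n e k m ≤ 2000000 * (((e + 3) ^ 3 * 2 ^ e + (k + 1) ^ 2 * 2 ^ k + m) * (n + 1) ^ 3) := by
  obtain ⟨h1, h2⟩ := cube_facts n
  have h3 : 1 ≤ 2 ^ e := Nat.one_le_two_pow
  have hu : (n + 1) ^ 3 ≤ (e + 1) * 2 ^ e * (n + 1) ^ 3 := Nat.le_mul_of_pos_left _ (by positivity)
  have h6 : (e + 1) * 2 ^ e * (n + 1) ^ 3 ≤ (e + 3) ^ 3 * 2 ^ e * (n + 1) ^ 3 := Nat.mul_le_mul_right _ (Nat.mul_le_mul_right _ (le_trans (by omega) (cube_facts (e + 2)).2))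
  have hw : 2 ^ e * (n + 1) ^ 3 ≤ (e + 1) * 2 ^ e * (n + 1) ^ 3 := by nlinarith
  have h9 : (k + 1) * 2 ^ k * (n + 1) ^ 3 ≤ (k + 1) ^ 2 * 2 ^ k * (n + 1) ^ 3 := Nat.mul_le_mul_right _ (Nat.mul_le_mul_right _ (by nlinarith))
  unfold alg1Cost
  linarith [a1TreeCost_le n e, a1CoefCost_le n e, bluesteinCost_le n k (2 ^ e + 1), a1Scan1Cost_le n k m, a1Scan2Cost_le n e, Nat.mul_le_mul_left (2 ^ e) h2,
    Nat.zero_le ((e + 3) ^ 3 * 2 ^ e * (n + 1) ^ 3), Nat.zero_le ((k + 1) ^ 2 * 2 ^ k * (n + 1) ^ 3), Nat.zero_le (m * (n + 1) ^ 3)]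

/-- The integer square root. [folklore] -/
theorem isqrtCost_le (n : ℕ) : isqrtCost n ≤ 80000 * (n + 1) ^ 4 := by
  unfold isqrtCost
  have h1 : (2 * n + 5) ^ 3 ≤ 125 * (n + 1) ^ 3 := by
    calc (2 * n + 5) ^ 3 ≤ (5 * (n + 1)) ^ 3 := Nat.pow_le_pow_left (by omega) 3
      _ = 125 * (n + 1) ^ 3 := by ring
  have h2 : (n + 1) ^ 4 = (n + 1) * (n + 1) ^ 3 := by ring
  obtain ⟨h3, h4⟩ := cube_facts n
  nlinarith [Nat.mul_le_mul_left (n + 1) h1]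

end CostBoundsA

section CostBoundsB

/-! ### Closed-form bounds on the costs, II: the base search and the fixed parts of Algorithm 2 -/

/-- The baby and giant steps. [folklore] -/
theorem sfValsCost_le (n e : ℕ) : sfValsCost n e ≤ 3000 * (((e + 1) * 2 ^ e) * (n + 1) ^ 3) := by
  obtain ⟨h1, h2⟩ := cube_facts n
  have h3 : 1 ≤ 2 ^ e := Nat.one_le_two_pow
  have hu : (n + 1) ^ 3 ≤ (e + 1) * 2 ^ e * (n + 1) ^ 3 := Nat.le_mul_of_pos_left _ (by positivity)
  have hw : 2 ^ e * (n + 1) ^ 3 ≤ (e + 1) * 2 ^ e * (n + 1) ^ 3 := by nlinarith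
  unfold sfValsCost
  linarith [toUnaryTerm_le e _ h1, powTerm_le n e _ (h2.trans (Nat.le_mul_of_pos_left _ h3)), Nat.mul_le_mul_left (2 ^ e) h2, Nat.mul_le_mul_left (2 ^ e) h1]

/-- The divisor casework. [folklore] -/
theorem sfDivsCost_le (n e : ℕ) : sfDivsCost n e ≤ 8800 * (((e + 1) * 2 ^ e) * (n + 1) ^ 3) := by
  obtain ⟨h1, h2⟩ := cube_facts n
  have h3 : 1 ≤ 2 ^ e := Nat.one_le_two_pow
  have hu : (n + 1) ^ 3 ≤ (e + 1) * 2 ^ e * (n + 1) ^ 3 := Nat.le_mul_of_pos_left _ (by positivity)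
  have hw : 2 ^ e * (n + 1) ^ 3 ≤ (e + 1) * 2 ^ e * (n + 1) ^ 3 := by nlinarith
  unfold sfDivsCost
  linarith [toUnaryTerm_le e _ h1, powTerm_le n e _ (h2.trans (Nat.le_mul_of_pos_left _ h3)), Nat.mul_le_mul_left (2 ^ e) h1]

/-- The class trial division (with `|enc (M/L)| ≤ n`). [folklore] -/
theorem sfClassCost_le {n M L : ℕ} (hML : (encodeNat (M / L)).length ≤ n) : sfClassCost n M L ≤ 1100 * ((M / L + 1) * (n + 1) ^ 3) := by
  obtain ⟨h1, h2⟩ := cube_facts n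
  have hT := toUnaryOf_le hML _ h2
  unfold sfClassCost
  linarith [Nat.mul_le_mul_left (M / L) h1, Nat.zero_le (M / L * (n + 1) ^ 3)]

/-- The set-up. [folklore] -/
theorem sfSetupCost_le (n e : ℕ) : sfSetupCost n e ≤ 3200 * (((e + 1) * 2 ^ e) * (n + 1) ^ 3) := by
  obtain ⟨h1, h2⟩ := cube_facts n
  have h3 : 1 ≤ 2 ^ e := Nat.one_le_two_pow
  have hu : (n + 1) ^ 3 ≤ (e + 1) * 2 ^ e * (n + 1) ^ 3 := Nat.le_mul_of_pos_left _ (by positivity)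
  unfold sfSetupCost
  linarith [sfValsCost_le n e, powTerm_le n e _ (h2.trans (Nat.le_mul_of_pos_left _ h3))]

/-- The exact-hit branch. [folklore] -/
theorem sfECost_le {n e M LB : ℕ} (hML : (encodeNat (M / LB)).length ≤ n) : sfECost n e M LB ≤ 10600 * (((e + 1) * 2 ^ e) * (n + 1) ^ 3) + 1100 * ((M / LB + 1) * (n + 1) ^ 3) := by
  obtain ⟨h1, h2⟩ := cube_facts n
  have h3 : 1 ≤ 2 ^ e := Nat.one_le_two_pow
  have hu : (n + 1) ^ 3 ≤ (e + 1) * 2 ^ e * (n + 1) ^ 3 := Nat.le_mul_of_pos_left _ (by positivity)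
  unfold sfECost
  linarith [sfDivsCost_le n e, sfClassCost_le hML]

/-- The dispatch. [folklore] -/
theorem sfDispatchCost_le {n e M LB : ℕ} (hML : (encodeNat (M / LB)).length ≤ n) : sfDispatchCost n e M LB ≤ 10700 * (((e + 1) * 2 ^ e) * (n + 1) ^ 3) + 1100 * ((M / LB + 1) * (n + 1) ^ 3) := by
  obtain ⟨h1, h2⟩ := cube_facts n
  have h3 : 1 ≤ 2 ^ e := Nat.one_le_two_pow
  have hu : (n + 1) ^ 3 ≤ (e + 1) * 2 ^ e * (n + 1) ^ 3 := Nat.le_mul_of_pos_left _ (by positivity)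
  unfold sfDispatchCost
  linarith [sfECost_le (e := e) hML]

/-- **One base of the search** costs `O(((e+3)³ 2^e + M/LB) (n+1)³)`. [folklore] -/
theorem sfBaseCost_le {n e M LB : ℕ} (hML : (encodeNat (M / LB)).length ≤ n) : sfBaseCost n e M LB ≤ 13000000 * (((e + 3) ^ 3 * 2 ^ e + M / LB + 1) * (n + 1) ^ 3) := by
  obtain ⟨h1, h2⟩ := cube_facts n
  have h3 : 1 ≤ 2 ^ e := Nat.one_le_two_pow
  have hu : (n + 1) ^ 3 ≤ (e + 1) * 2 ^ e * (n + 1) ^ 3 := Nat.le_mul_of_pos_left _ (by positivity)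
  have h6 : (e + 1) * 2 ^ e * (n + 1) ^ 3 ≤ (e + 3) ^ 3 * 2 ^ e * (n + 1) ^ 3 := Nat.mul_le_mul_right _ (Nat.mul_le_mul_right _ (le_trans (by omega) (cube_facts (e + 2)).2))
  have hA := alg1Cost_le n e (e + 2) (2 ^ e)
  have h7 : (e + 2 + 1) ^ 2 * 2 ^ (e + 2) * (n + 1) ^ 3 ≤ 4 * ((e + 3) ^ 3 * 2 ^ e * (n + 1) ^ 3) := by
    rw [show e + 2 + 1 = e + 3 by ring, pow_add, show (2 : ℕ) ^ 2 = 4 by norm_num]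
    have : (e + 3) ^ 2 ≤ (e + 3) ^ 3 := Nat.pow_le_pow_right (by omega) (by omega)
    nlinarith [Nat.mul_le_mul_right (2 ^ e * (n + 1) ^ 3) this]
  have hw : 2 ^ e * (n + 1) ^ 3 ≤ (e + 1) * 2 ^ e * (n + 1) ^ 3 := by nlinarith
  unfold sfBaseCost
  linarith [sfSetupCost_le n e, sfDispatchCost_le (e := e) hML, Nat.zero_le (M / LB * (n + 1) ^ 3), Nat.zero_le ((e + 3) ^ 3 * 2 ^ e * (n + 1) ^ 3)]

/-- One base of the loop. [folklore] -/
theorem sfStepCost_le {n e M LB : ℕ} (hML : (encodeNat (M / LB)).length ≤ n) : sfStepCost n e M LB ≤ 13000100 * (((e + 3) ^ 3 * 2 ^ e + M / LB + 1) * (n + 1) ^ 3) := by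
  obtain ⟨h1, h2⟩ := cube_facts n
  unfold sfStepCost
  linarith [sfBaseCost_le (e := e) hML, Nat.zero_le (M / LB * (n + 1) ^ 3), Nat.zero_le ((e + 3) ^ 3 * 2 ^ e * (n + 1) ^ 3)]

/-- **The base search** costs `O((B+1) ((e+3)³ 2^e + M/LB + 1) (n+1)³)`. [folklore] -/
theorem sfSearchCost_le {n e M LB B : ℕ} (hML : (encodeNat (M / LB)).length ≤ n) (hB : (encodeNat B).length ≤ n) :
    sfSearchCost n e M LB B ≤ 13000200 * ((B + 1) * (((e + 3) ^ 3 * 2 ^ e + M / LB + 1) * (n + 1) ^ 3)) := by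
  obtain ⟨h1, h2⟩ := cube_facts n
  set U := ((e + 3) ^ 3 * 2 ^ e + M / LB + 1) * (n + 1) ^ 3 with hU
  have hcU : (n + 1) ^ 3 ≤ U := by rw [hU]; exact Nat.le_mul_of_pos_left _ (by positivity)
  have hS := sfStepCost_le (e := e) hML
  rw [← hU] at hS
  have hT := toUnaryOf_le hB _ h2
  have hBS : B * (sfStepCost n e M LB + 2) ≤ B * (13000102 * U) := Nat.mul_le_mul_left B (by linarith)
  unfold sfSearchCost
  nlinarith [Nat.zero_le (B * U)]

/-- Values below `2ⁿ` have `n`-bit codes. [folklore] -/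
private theorem len_le_of_lt_two_pow {x n : ℕ} (hx : x < 2 ^ n) : (encodeNat x).length ≤ n := by
  rw [TM2Pass.length_encodeNat_eq_size]; exact Nat.size_le.2 hx

/-- The initialisation of Algorithm 2. [folklore] -/
theorem a2InitCost_le (n : ℕ) : a2InitCost n ≤ 86000 * (n + 1) ^ 4 := by
  unfold a2InitCost
  have := isqrtCost_le n
  have h4 : (n + 1) ^ 4 = (n + 1) * (n + 1) ^ 3 := by ring
  nlinarith [(cube_facts n).1]

/-- Step 1 of Algorithm 2 (with `m ≤ 2ⁿ`). [folklore] -/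
theorem a2PowCost_le {n m : ℕ} (hm : m ≤ 2 ^ n) : a2PowCost n m ≤ 3800 * ((m + 1) * (n + 1) ^ 3) := by
  obtain ⟨h1, h2⟩ := cube_facts n
  have hsub : m - 1 ≤ m := Nat.sub_le m 1
  have hl : (encodeNat (m - 1)).length ≤ n := by
    rcases Nat.eq_zero_or_pos m with rfl | hm0
    · exact (Nat.zero_le _).trans' (by rw [show encodeNat (0 - 1) = [] by rfl]; rfl)
    · exact len_le_of_lt_two_pow (by omega)
  have hT := toUnaryOf_le hl _ h2
  unfold a2PowCost
  nlinarith [Nat.mul_le_mul_right ((n + 1) ^ 3) hsub, Nat.mul_le_mul_left m h1]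

/-- The baby-step words (with `m < 2ⁿ`). [folklore] -/
theorem a2BabyCost_le {n m : ℕ} (hm : m < 2 ^ n) : a2BabyCost n m ≤ 1400 * ((m + 1) * (n + 1) ^ 3) := by
  obtain ⟨h1, h2⟩ := cube_facts n
  have hT := toUnaryOf_le (len_le_of_lt_two_pow hm) _ h2
  unfold a2BabyCost
  nlinarith [Nat.mul_le_mul_left m h1]

/-- One pair of giant steps (with `J < 2ⁿ`). [folklore] -/
theorem a2PairCost_le {n J : ℕ} (hJ : J < 2 ^ n) : a2PairCost n J ≤ 170000 * ((J + 1) * (n + 1) ^ 4) := by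
  obtain ⟨h1, h2⟩ := cube_facts n
  have hT := toUnaryOf_le (len_le_of_lt_two_pow hJ) _ h2
  have hI := isqrtCost_le n
  have h4 : (n + 1) ^ 4 = (n + 1) * (n + 1) ^ 3 := by ring
  have h5 : (n + 1) ^ 3 ≤ (n + 1) ^ 4 := Nat.pow_le_pow_right (by omega) (by omega)
  unfold a2PairCost
  nlinarith [Nat.mul_le_mul_left J h1, Nat.mul_le_mul_left J h5, Nat.zero_le (J * (n + 1) ^ 4)]

/-- The square-root branch. [folklore] -/
theorem a2RecoverCost_le (n : ℕ) : a2RecoverCost n ≤ 170000 * (n + 1) ^ 4 := by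
  unfold a2RecoverCost
  have := isqrtCost_le n
  have h4 : (n + 1) ^ 4 = (n + 1) * (n + 1) ^ 3 := by ring
  nlinarith [(cube_facts n).1]

/-- One word of the scan (with `nb ≤ n`). [folklore] -/
theorem a2ScanBodyCost_le {n nb : ℕ} (hnb : nb ≤ n) : a2ScanBodyCost n nb ≤ 171000 * (n + 1) ^ 4 := by
  unfold a2ScanBodyCost a2ScanKeyCost
  have := a2RecoverCost_le n
  have h4 : (n + 1) ^ 4 = (n + 1) * (n + 1) ^ 3 := by ring
  nlinarith [(cube_facts n).1, (cube_facts n).2]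

/-- The scan of `L` words. [folklore] -/
theorem a2ScanCost_le {n nb : ℕ} (hnb : nb ≤ n) (L : ℕ) : a2ScanCost n nb L ≤ 172000 * ((L + 1) * (n + 1) ^ 4) := by
  unfold a2ScanCost
  have hb := a2ScanBodyCost_le hnb
  have h4 : (n + 1) ^ 4 = (n + 1) * (n + 1) ^ 3 := by ring
  have h5 : 1 ≤ (n + 1) ^ 4 := Nat.one_le_pow _ _ (by omega)
  have : L * (a2ScanBodyCost n nb + 2) ≤ L * (171002 * (n + 1) ^ 4) := Nat.mul_le_mul_left L (by linarith)
  nlinarith [(cube_facts n).1]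

/-- The padded values (with `P ≤ 2ⁿ⁺¹`-free form). [folklore] -/
theorem a2SixPCost_le (n P : ℕ) : a2SixPCost n P ≤ 400 * ((P + 1) * (n + 1) ^ 3) := by
  obtain ⟨h1, h2⟩ := cube_facts n
  unfold a2SixPCost
  nlinarith [Nat.mul_le_mul_left P h1, Nat.mul_le_mul_left P h2]

/-- `2^{|enc x|} ≤ 2x + 1`. [folklore] -/
private theorem two_pow_len_le (x : ℕ) : 2 ^ (encodeNat x).length ≤ 2 * x + 1 := by
  rw [TM2Pass.length_encodeNat_eq_size]
  rcases Nat.eq_zero_or_pos x with rfl | hx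
  · simp
  · have : 2 ^ (Nat.size x - 1) ≤ x := Nat.lt_size.1 (by have := Nat.size_pos.2 hx; omega)
    have h2 : 2 ^ Nat.size x = 2 * 2 ^ (Nat.size x - 1) := by rw [← pow_succ']; congr 1; have := Nat.size_pos.2 hx; omega
    omega

/-- Algorithm 1 on the padded values (with `cnt ≤ 2ⁿ`, `m ≤ 2ⁿ`). [folklore] -/
theorem a2SixRCost_le {n m cnt : ℕ} (hcnt : cnt ≤ 2 ^ n) (hm : m ≤ 2 ^ n) (hn : 1 ≤ n) :
    a2SixRCost n (a2E cnt) (a2K (2 ^ a2E cnt) m) m ≤ 700000000 * ((cnt + m + 1) * (n + 1) ^ 6) := by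
  obtain ⟨h1, h2⟩ := cube_facts n
  have h2n : 2 ≤ 2 ^ n := by calc (2 : ℕ) = 2 ^ 1 := by norm_num
    _ ≤ 2 ^ n := Nat.pow_le_pow_right (by omega) hn
  -- `2^e ≤ 2 cnt + 1`, `e ≤ n + 1`
  have hPle : 2 ^ a2E cnt ≤ 2 * cnt + 1 := by
    rw [a2E]; have := two_pow_len_le (cnt - 1); omega
  have hele : a2E cnt ≤ n + 1 := by
    rw [a2E, TM2Pass.length_encodeNat_eq_size]; refine Nat.size_le.2 ?_
    calc cnt - 1 ≤ cnt := Nat.sub_le _ _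
      _ ≤ 2 ^ n := hcnt
      _ < 2 ^ (n + 1) := Nat.pow_lt_pow_right (by omega) (by omega)
  -- `2^k ≤ 4 (2^e + m) + 2`, `k ≤ n + 3`
  have hk2 : 2 ^ a2K (2 ^ a2E cnt) m ≤ 4 * (2 ^ a2E cnt + m) + 2 := by
    rw [a2K, pow_succ]; have := two_pow_len_le (2 ^ a2E cnt + m); omega
  have hkle : a2K (2 ^ a2E cnt) m ≤ n + 3 := by
    rw [a2K, TM2Pass.length_encodeNat_eq_size]
    have hlt : 2 ^ a2E cnt + m < 2 ^ (n + 2) := by rw [pow_add]; norm_num; omega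
    have : Nat.size (2 ^ a2E cnt + m) ≤ n + 2 := Nat.size_le.2 hlt
    omega
  have hA := alg1Cost_le n (a2E cnt) (a2K (2 ^ a2E cnt) m) m
  have hu1 : (a2E cnt + 3) ^ 3 * 2 ^ a2E cnt ≤ 64 * (n + 1) ^ 3 * (2 * cnt + 1) := by
    have : (a2E cnt + 3) ^ 3 ≤ (4 * (n + 1)) ^ 3 := Nat.pow_le_pow_left (by omega) 3
    calc (a2E cnt + 3) ^ 3 * 2 ^ a2E cnt ≤ (4 * (n + 1)) ^ 3 * (2 * cnt + 1) := Nat.mul_le_mul this hPle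
      _ = 64 * (n + 1) ^ 3 * (2 * cnt + 1) := by ring
  have hu2 : (a2K (2 ^ a2E cnt) m + 1) ^ 2 * 2 ^ a2K (2 ^ a2E cnt) m ≤ 16 * (n + 1) ^ 3 * (4 * (2 * cnt + 1 + m) + 2) := by
    have h3 : (a2K (2 ^ a2E cnt) m + 1) ^ 2 ≤ (4 * (n + 1)) ^ 2 := Nat.pow_le_pow_left (by omega) 2
    have hsq : (4 * (n + 1)) ^ 2 ≤ 16 * (n + 1) ^ 3 := by
      have : (n + 1) ^ 2 ≤ (n + 1) ^ 3 := Nat.pow_le_pow_right (by omega) (by omega)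
      nlinarith
    calc (a2K (2 ^ a2E cnt) m + 1) ^ 2 * 2 ^ a2K (2 ^ a2E cnt) m ≤ (4 * (n + 1)) ^ 2 * (4 * (2 ^ a2E cnt + m) + 2) := Nat.mul_le_mul h3 hk2
      _ ≤ 16 * (n + 1) ^ 3 * (4 * (2 * cnt + 1 + m) + 2) := Nat.mul_le_mul hsq (by omega)
  have hU : ((a2E cnt + 3) ^ 3 * 2 ^ a2E cnt + (a2K (2 ^ a2E cnt) m + 1) ^ 2 * 2 ^ a2K (2 ^ a2E cnt) m + m) * (n + 1) ^ 3 ≤ (300 * (cnt + m + 1) * (n + 1) ^ 3) * (n + 1) ^ 3 := by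
    apply Nat.mul_le_mul_right
    linarith [Nat.mul_le_mul_left m h1, Nat.zero_le (cnt * (n + 1) ^ 3), Nat.zero_le (m * (n + 1) ^ 3)]
  have h6 : (n + 1) ^ 6 = (n + 1) ^ 3 * (n + 1) ^ 3 := by ring
  unfold a2SixRCost
  nlinarith [Nat.zero_le ((cnt + m) * (n + 1) ^ 6)]

end CostBoundsB

section CostBoundsB2

/-! ### Closed-form bounds on the costs, III: the giant steps of Algorithm 2 and the candidate count

The number of giant-step words is `Σ_{ab ≤ r} J_{a,b}` with
`J_{a,b} = ⌊(⌊√N⌋+1)/(4rm⌊√(ab)⌋)⌋ + 1`; by Harvey's count (`Harvey2021Search.candidate_count_le`,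
the sum `Σ 1/√(ab)`) this is `O((√N/(m√r) + r) log r)`. -/

open Finset in
/-- `lsum` is a `Finset` sum. [folklore] -/
theorem lsum_eq_sum (f : ℕ → ℕ) : ∀ k, lsum f k = ∑ i ∈ range k, f i
  | 0 => rfl
  | k + 1 => by rw [lsum, lsum_eq_sum f k, sum_range_succ]

open Finset in
/-- Reflection of a counted sum. [folklore] -/
theorem sum_range_reflect' (f : ℕ → ℕ) (K : ℕ) : ∑ k ∈ range K, f (K - k) = ∑ b ∈ range K, f (b + 1) := by
  rw [← sum_range_reflect (fun b => f (b + 1)) K]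
  refine sum_congr rfl fun k hk => ?_
  rw [mem_range] at hk
  congr 1; omega

open Finset in
/-- The candidate count of Algorithm 2 (pairs and words of the giant steps). [folklore] -/
def pairSum (N m r : ℕ) : ℕ := ∑ a ∈ range r, ∑ b ∈ range (r / (a + 1)), (jCount N m r (a + 1) (b + 1) + 1)

open Finset in
/-- The number of giant-step words. [folklore] -/
theorem length_giantWords_eq (N α m r nb : ℕ) : ∀ ad, (giantWords N α m r nb ad).length = ∑ a ∈ range ad, ∑ b ∈ range (r / (a + 1)), jCount N m r (a + 1) (b + 1)
  | 0 => by simp [giantWords]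
  | ad + 1 => by
    have hrow : ∀ a bd, (rowWords N α m r nb a bd).length = ∑ b ∈ range bd, jCount N m r a (b + 1) := by
      intro a bd; induction bd with
      | zero => simp [rowWords]
      | succ bd ih => simp only [rowWords, List.length_append, ih, pairWords, List.length_map, List.length_range, sum_range_succ]
    rw [giantWords, List.length_append, length_giantWords_eq N α m r nb ad, hrow, sum_range_succ]

open Finset in
/-- The number of words of Algorithm 2 is at most `m + pairSum`. [folklore] -/
theorem length_a2Words_le (N α m r : ℕ) : (a2Words N α m r).length ≤ m + pairSum N m r := by
  simp only [a2Words, List.length_append, babyWords, List.length_map, List.length_range, length_giantWords_eq, pairSum]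
  apply Nat.add_le_add_left
  exact sum_le_sum fun a _ => sum_le_sum fun b _ => Nat.le_succ _

open Finset in
/-- Sums over `[1, r]` as counted sums. [folklore] -/
theorem sum_Icc_one_eq {M : Type*} [AddCommMonoid M] (f : ℕ → M) (r : ℕ) : ∑ a ∈ Icc 1 r, f a = ∑ a ∈ range r, f (a + 1) := by
  rw [show Icc 1 r = Ico 1 (r + 1) by ext x; simp, sum_Ico_eq_sum_range]
  simp [add_comm]

open Finset Real in
/-- **The candidate count** (Harvey, proof of Prop. 4.2): `Σ_{ab ≤ r} (J_{a,b} + 1) ≤ ((⌊√N⌋+1)/(m⌊√r⌋) + 2r + 3)(|r|₂ + 1)`.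
[cite: Harvey2021, arXiv v3 proof of Prop. 15] -/
theorem pairSum_le {N m r : ℕ} (hr : 1 ≤ r) (hm : 1 ≤ m) :
    pairSum N m r ≤ ((Nat.sqrt N + 1) / (m * Nat.sqrt r) + 2 * r + 3) * (Nat.size r + 1) := by
  set A := Nat.sqrt N + 1 with hA
  have hr0 : (0 : ℝ) < r := by exact_mod_cast hr
  have hm0 : (0 : ℝ) < m := by exact_mod_cast hm
  set Xr : ℝ := (A : ℝ) / (4 * r * m) with hXr
  have hXr0 : 0 ≤ Xr := by rw [hXr]; positivity
  -- one term
  have hterm : ∀ a b : ℕ, 1 ≤ a → 1 ≤ b → ((jCount N m r a b + 1 : ℕ) : ℝ) ≤ 2 * (Xr / Real.sqrt ((a : ℝ) * b) + 1) := by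
    intro a b ha hb
    have hab : 1 ≤ a * b := Nat.one_le_iff_ne_zero.2 (Nat.mul_ne_zero (by omega) (by omega))
    set s := Nat.sqrt (a * b) with hs
    have hs1 : 1 ≤ s := by rw [hs]; exact Nat.le_sqrt.2 (by simpa using hab)
    have hs0 : (0 : ℝ) < s := by exact_mod_cast hs1
    have hsq : Real.sqrt ((a : ℝ) * b) < (s : ℝ) + 1 := by
      have := Real.real_sqrt_lt_nat_sqrt_succ (a := a * b); push_cast at this; rw [← hs] at this; exact this
    have hsq0 : 0 < Real.sqrt ((a : ℝ) * b) := Real.sqrt_pos.2 (by exact_mod_cast (show 0 < a * b by omega))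
    have hdiv : ((A / (4 * r * m * s) : ℕ) : ℝ) ≤ Xr / s := by
      refine (Nat.cast_div_le).trans (le_of_eq ?_)
      rw [hXr]; push_cast; rw [div_div]
    have hinv : Xr / s ≤ 2 * (Xr / Real.sqrt ((a : ℝ) * b)) := by
      have hs1' : (1 : ℝ) ≤ s := by exact_mod_cast hs1
      calc Xr / s ≤ Xr / (Real.sqrt ((a : ℝ) * b) / 2) := div_le_div_of_nonneg_left hXr0 (by positivity) (by linarith)
        _ = 2 * (Xr / Real.sqrt ((a : ℝ) * b)) := by field_simp
    have hj : ((jCount N m r a b + 1 : ℕ) : ℝ) = ((A / (4 * r * m * s) : ℕ) : ℝ) + 2 := by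
      simp only [jCount, ← hA, ← hs]; push_cast; ring
    rw [hj]; linarith
  -- the double sum
  have hsum : (pairSum N m r : ℝ) ≤ 2 * ((2 * Xr * Real.sqrt r + r) * (1 + Real.log r)) := by
    have hC := Literature.Computability.Cryptography.Harvey2021.candidate_count_le r hXr0
    rw [sum_Icc_one_eq] at hC
    simp_rw [sum_Icc_one_eq] at hC
    unfold pairSum; push_cast
    calc ∑ a ∈ range r, ∑ b ∈ range (r / (a + 1)), ((jCount N m r (a + 1) (b + 1) : ℝ) + 1)
        ≤ ∑ a ∈ range r, ∑ b ∈ range (r / (a + 1)), 2 * (Xr / Real.sqrt (((a + 1 : ℕ) : ℝ) * ((b + 1 : ℕ) : ℝ)) + 1) := by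
          refine sum_le_sum fun a _ => sum_le_sum fun b _ => ?_
          have := hterm (a + 1) (b + 1) (by omega) (by omega); push_cast at this ⊢; exact this
      _ = 2 * ∑ a ∈ range r, ∑ b ∈ range (r / (a + 1)), (Xr / Real.sqrt (((a + 1 : ℕ) : ℝ) * ((b + 1 : ℕ) : ℝ)) + 1) := by
          rw [mul_sum]; refine sum_congr rfl fun a _ => ?_; rw [mul_sum]
      _ ≤ 2 * ((2 * Xr * Real.sqrt r + r) * (1 + Real.log r)) := by
          refine mul_le_mul_of_nonneg_left ?_ (by norm_num)
          convert hC using 2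
  -- the closed form
  set sr := Nat.sqrt r with hsr
  have hsr1 : 1 ≤ sr := by rw [hsr]; exact Nat.le_sqrt.2 (by simpa using hr)
  have hsr0 : (0 : ℝ) < sr := by exact_mod_cast hsr1
  have hsrle : (sr : ℝ) ≤ Real.sqrt r := by rw [hsr]; exact Real.nat_sqrt_le_real_sqrt
  have hsqr : 0 < Real.sqrt r := Real.sqrt_pos.2 hr0
  have h4 : 4 * Xr * Real.sqrt r = (A : ℝ) / (m * Real.sqrt r) := by
    rw [hXr]; field_simp; rw [Real.sq_sqrt hr0.le]
  have h5 : (A : ℝ) / (m * Real.sqrt r) ≤ (A : ℝ) / (m * sr) := div_le_div_of_nonneg_left (by positivity) (by positivity) (by nlinarith)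
  have h6 : (A : ℝ) / (m * sr) ≤ ((A / (m * sr) : ℕ) : ℝ) + 1 := by
    have := Nat.lt_mul_div_succ A (show 0 < m * sr from Nat.mul_pos hm hsr1)
    rw [div_le_iff₀ (by positivity)]
    have h' : ((A : ℕ) : ℝ) < ((m * sr : ℕ) : ℝ) * (((A / (m * sr) : ℕ) : ℝ) + 1) := by exact_mod_cast this
    push_cast at h' ⊢; linarith
  have hlog : Real.log r ≤ Nat.size r := by
    have h1 : (r : ℝ) < (2 : ℝ) ^ Nat.size r := by exact_mod_cast Nat.lt_size_self r
    have h2 := Real.log_lt_log hr0 h1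
    rw [Real.log_pow] at h2
    have h3 : (Nat.size r : ℝ) * Real.log 2 ≤ Nat.size r * 1 := mul_le_mul_of_nonneg_left (by linarith [Real.log_two_lt_d9]) (by positivity)
    linarith
  have hlog0 : 0 ≤ Real.log r := Real.log_nonneg (by exact_mod_cast hr)
  have hfin : (pairSum N m r : ℝ) ≤ ((((A / (m * sr) : ℕ) : ℝ) + 2 * r + 3) * (Nat.size r + 1)) := by
    calc (pairSum N m r : ℝ) ≤ 2 * ((2 * Xr * Real.sqrt r + r) * (1 + Real.log r)) := hsum
      _ = ((A : ℝ) / (m * Real.sqrt r) + 2 * r) * (1 + Real.log r) := by rw [← h4]; ring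
      _ ≤ (((A / (m * sr) : ℕ) : ℝ) + 2 * r + 3) * (Nat.size r + 1) := by
          apply mul_le_mul (by linarith) (by linarith) (by linarith) (by positivity)
  exact_mod_cast hfin

open Finset in
/-- The words of one row `a` with `Bc` pairs: the row count. [folklore] -/
def rowW (N m r a Bc : ℕ) : ℕ := ∑ b ∈ range Bc, (jCount N m r a (b + 1) + 1)

open Finset in
/-- **One row of giant steps** costs `O((rowW + 1)(n+1)⁴)`. [folklore] -/
theorem a2RowCost_le {N n m r a Bc : ℕ} (hBc : Bc < 2 ^ n) (hJ : ∀ b, 1 ≤ b → jCount N m r a b < 2 ^ n) :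
    a2RowCost N n m r a Bc ≤ 171000 * ((rowW N m r a Bc + 1) * (n + 1) ^ 4) := by
  obtain ⟨h1, h2⟩ := cube_facts n
  have h4 : (n + 1) ^ 4 = (n + 1) * (n + 1) ^ 3 := by ring
  have h5 : (n + 1) ^ 3 ≤ (n + 1) ^ 4 := Nat.pow_le_pow_right (by omega) (by omega)
  have hT := toUnaryOf_le (len_le_of_lt_two_pow hBc) _ h2
  have hl : lsum (a2RowF N n m r a Bc) Bc ≤ 170083 * (rowW N m r a Bc * (n + 1) ^ 4) := by
    rw [lsum_eq_sum, show (fun i => a2RowF N n m r a Bc i) = fun i => (fun x => 83 * (n + 1) ^ 3 + a2PairCost n (jCount N m r a x)) (Bc - i) from rfl,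
      sum_range_reflect' (fun x => 83 * (n + 1) ^ 3 + a2PairCost n (jCount N m r a x)) Bc, rowW, sum_mul, mul_sum]
    refine sum_le_sum fun b _ => ?_
    have := a2PairCost_le (hJ (b + 1) (by omega))
    nlinarith
  have hB : Bc ≤ rowW N m r a Bc := by
    unfold rowW
    calc Bc = ∑ b ∈ range Bc, 1 := by simp
      _ ≤ _ := sum_le_sum fun b _ => by omega
  unfold a2RowCost
  nlinarith [Nat.mul_le_mul_right ((n + 1) ^ 4) hB, Nat.zero_le (rowW N m r a Bc * (n + 1) ^ 4)]

open Finset in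
/-- The row counts add up to the candidate count. [folklore] -/
theorem sum_rowW (N m r : ℕ) : ∑ a ∈ range r, rowW N m r (a + 1) (r / (a + 1)) = pairSum N m r := rfl

open Finset in
/-- **The giant-step pass** costs `O((pairSum + r + 1)(n+1)⁴)`. [folklore] -/
theorem a2GiantsCost_le {N n m r : ℕ} (hr : r < 2 ^ n) (hJ : ∀ a b, 1 ≤ a → 1 ≤ b → jCount N m r a b < 2 ^ n) :
    a2GiantsCost N n m r ≤ 171200 * ((pairSum N m r + r + 1) * (n + 1) ^ 4) := by
  obtain ⟨h1, h2⟩ := cube_facts n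
  have h5 : (n + 1) ^ 3 ≤ (n + 1) ^ 4 := Nat.pow_le_pow_right (by omega) (by omega)
  have hT := toUnaryOf_le (len_le_of_lt_two_pow hr) _ h2
  have hl : lsum (a2GiantsF N n m r) r ≤ 171083 * ((pairSum N m r + r) * (n + 1) ^ 4) := by
    rw [lsum_eq_sum, show (fun i => a2GiantsF N n m r i) = fun i => (fun x => 83 * (n + 1) ^ 3 + a2RowCost N n m r x (r / x)) (r - i) from rfl,
      sum_range_reflect' (fun x => 83 * (n + 1) ^ 3 + a2RowCost N n m r x (r / x)) r, ← sum_rowW, add_mul, sum_mul,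
      show r * (n + 1) ^ 4 = ∑ a ∈ range r, (n + 1) ^ 4 by simp, mul_add, mul_sum, mul_sum, ← sum_add_distrib]
    refine sum_le_sum fun a _ => ?_
    have := a2RowCost_le (N := N) (m := m) (r := r) (a := a + 1) (Bc := r / (a + 1)) (lt_of_le_of_lt (Nat.div_le_self _ _) hr) (fun b hb => hJ (a + 1) b (by omega) hb)
    nlinarith
  unfold a2GiantsCost
  nlinarith [Nat.zero_le ((pairSum N m r + r) * (n + 1) ^ 4)]

/-- **The sort** of words of length `≤ 3n` with `nb ≤ n` key bits costs `O((|ws| + 1)(n+1)³)`. [folklore] -/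
theorem a2SortCost_le {n nb : ℕ} (hnb : nb ≤ n) {ws : List (List Bool)} (hws : ∀ w ∈ ws, w.length ≤ 3 * n) :
    a2SortCost n nb ws ≤ 200 * ((ws.length + 1) * (n + 1) ^ 3) := by
  obtain ⟨h1, h2⟩ := cube_facts n
  have hE : (encList ws).length ≤ ws.length * (6 * n + 2) := by
    rw [length_encList]
    have := List.sum_le_card_nsmul (ws.map fun a => 2 * a.length + 2) (6 * n + 2) (by
      intro x hx; obtain ⟨w, hw, rfl⟩ := List.mem_map.1 hx; have := hws w hw; omega)
    simpa using this
  have hP : Radix.passCost nb ws ≤ ws.length * (75 * n + 30) + 6 := by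
    unfold Radix.passCost
    have := List.sum_le_card_nsmul (ws.map fun v => 21 * v.length + 12 * nb + 30) (75 * n + 30) (by
      intro x hx; obtain ⟨w, hw, rfl⟩ := List.mem_map.1 hx; have := hws w hw; nlinarith)
    simp only [List.length_map, smul_eq_mul] at this; omega
  have hnP : nb * (Radix.passCost nb ws + 3) ≤ n * (ws.length * (75 * n + 30) + 9) := Nat.mul_le_mul hnb (by omega)
  have hsq : n * n ≤ (n + 1) ^ 3 := by nlinarith
  unfold a2SortCost
  nlinarith [Nat.mul_le_mul_left ws.length hsq, Nat.mul_le_mul_left ws.length h2, Nat.mul_le_mul_left ws.length h1]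

/-- The count handed to Step 4 is at most the number of words. [folklore] -/
theorem a2CntOf_le (N α m r : ℕ) : a2CntOf N α m r ≤ (a2Words N α m r).length := by
  unfold a2CntOf
  split
  · exact Nat.zero_le _
  · have := scanRun_acc_length_le N m (encodeNat N).length (radixIter (a2Words N α m r) (encodeNat N).length) ScanSt.init
    rw [length_radixIter] at this; simpa [a2Res, ScanSt.init] using this

/-- **The end of Algorithm 2** costs `O((cnt + m + 1)(n+1)⁶)`. [folklore] -/
theorem a2FinCost_le {n m cnt : ℕ} (hcnt : cnt ≤ 2 ^ n) (hm : m ≤ 2 ^ n) (hn : 1 ≤ n) :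
    a2FinCost n m cnt ≤ 700100000 * ((cnt + m + 1) * (n + 1) ^ 6) := by
  obtain ⟨h1, h2⟩ := cube_facts n
  have hR := a2SixRCost_le hcnt hm hn
  have hP := a2SixPCost_le n (2 ^ a2E cnt)
  have hPle : 2 ^ a2E cnt ≤ 2 * cnt + 1 := by rw [a2E]; have := two_pow_len_le (cnt - 1); omega
  have h36 : (n + 1) ^ 3 ≤ (n + 1) ^ 6 := Nat.pow_le_pow_right (by omega) (by omega)
  have hpt := powTerm_le n n _ h2
  unfold a2FinCost a2SixCost
  nlinarith [Nat.mul_le_mul_left cnt h36, Nat.mul_le_mul_left cnt h2, Nat.mul_le_mul_right ((n + 1) ^ 3) hPle, Nat.zero_le ((cnt + m) * (n + 1) ^ 6), Nat.mul_le_mul_left m h36]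

/-- **Algorithm 2** costs `O((m + r + pairSum + 1)(n+1)⁶)`. [folklore] -/
theorem alg2Cost_le {N n α m r : ℕ} (hN1 : 1 < N) (hn : 2 * (encodeNat N).length + 8 ≤ n) (hm1 : 1 ≤ m) (hmN : m ≤ N) (hr1 : 1 ≤ r) (hrN : r ≤ N)
    (hw : ∀ w ∈ a2Words N α m r, w.length ≤ 3 * n) :
    alg2Cost N n α m r ≤ 1500000000 * ((m + r + pairSum N m r + 1) * (n + 1) ^ 6) := by
  obtain ⟨h1, h2⟩ := cube_facts n
  have hNlt : N < 2 ^ (encodeNat N).length := by rw [TM2Pass.length_encodeNat_eq_size]; exact Nat.lt_size_self N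
  have h2n : 2 ^ (2 * (encodeNat N).length + 8) ≤ 2 ^ n := Nat.pow_le_pow_right (by omega) hn
  have h2nX : 2 ^ (2 * (encodeNat N).length + 8) = 2 ^ (encodeNat N).length * (2 ^ (encodeNat N).length * 256) := by
    rw [show 2 * (encodeNat N).length + 8 = (encodeNat N).length + ((encodeNat N).length + 8) by ring, pow_add, pow_add]; norm_num
  have hX1 : 1 ≤ 2 ^ (encodeNat N).length := Nat.one_le_two_pow
  have hNn : N * 256 < 2 ^ n := by
    calc N * 256 < 2 ^ (encodeNat N).length * 256 := Nat.mul_lt_mul_of_pos_right hNlt (by norm_num)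
      _ ≤ 2 ^ (encodeNat N).length * (2 ^ (encodeNat N).length * 256) := Nat.mul_le_mul_left _ (Nat.le_mul_of_pos_left _ (by positivity))
      _ ≤ 2 ^ n := by rw [← h2nX]; exact h2n
  have hNN : 3 * N * N < 2 ^ n := by
    calc 3 * N * N < 2 ^ (encodeNat N).length * (2 ^ (encodeNat N).length * 256) := by nlinarith
      _ ≤ 2 ^ n := by rw [← h2nX]; exact h2n
  have hmn : m < 2 ^ n := by omega
  have hrn : r < 2 ^ n := by omega
  have hn1 : 1 ≤ n := by omega
  have hJ : ∀ a b, 1 ≤ a → 1 ≤ b → jCount N m r a b < 2 ^ n := fun a b ha hb => by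
    have hj := jCount_le_JStar (N := N) ha hb hr1 hm1
    have : a2JStar N m r ≤ N + 2 := by
      unfold a2JStar; have := Nat.div_le_self (Nat.sqrt N + 1) (4 * r * m); have := Nat.sqrt_le_self N; omega
    omega
  have hW := length_a2Words_le N α m r
  have hW2 : (a2Words N α m r).length ≤ 2 ^ n := by
    have := length_words_le (N := N) (α := α) (C := a2C N α m r) (nb := (encodeNat N).length) hN1 hr1 hrN hm1 hmN
    rw [a2Words]; omega
  have hcnt := a2CntOf_le N α m r
  have hA := a2InitCost_le n
  have hPw := a2PowCost_le hmn.le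
  have hB := a2BabyCost_le hmn
  have hG := a2GiantsCost_le (N := N) (m := m) hrn hJ
  have hS := a2SortCost_le (nb := (encodeNat N).length) (by omega) hw
  have hSc := a2ScanCost_le (nb := (encodeNat N).length) (n := n) (by omega) (a2Words N α m r).length
  have hF := a2FinCost_le (hcnt.trans hW2) hmn.le hn1
  have h46 : (n + 1) ^ 4 ≤ (n + 1) ^ 6 := Nat.pow_le_pow_right (by omega) (by omega)
  have h36 : (n + 1) ^ 3 ≤ (n + 1) ^ 6 := Nat.pow_le_pow_right (by omega) (by omega)
  have k1 := Nat.mul_le_mul_left (m + 1) h36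
  have k2 := Nat.mul_le_mul_left (pairSum N m r + r + 1) h46
  have k3 := Nat.mul_le_mul_left ((a2Words N α m r).length + 1) h36
  have k4 := Nat.mul_le_mul_left ((a2Words N α m r).length + 1) h46
  have k5 := Nat.mul_le_mul_right ((n + 1) ^ 6) (show (a2Words N α m r).length + 1 ≤ m + pairSum N m r + 1 by omega)
  have k6 := Nat.mul_le_mul_right ((n + 1) ^ 6) (show a2CntOf N α m r + m + 1 ≤ 2 * m + pairSum N m r + 1 by omega)
  have k7 : 1 ≤ (n + 1) ^ 6 := Nat.one_le_pow _ _ (by omega)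
  unfold alg2Cost a2ListsCost
  linarith [Nat.zero_le (m * (n + 1) ^ 6), Nat.zero_le (r * (n + 1) ^ 6), Nat.zero_le (pairSum N m r * (n + 1) ^ 6)]

end CostBoundsB2

section CostBoundsC

/-! ### Closed-form bounds on the costs, IV: the per-number procedure, the rounds, the whole machine

With `n = 4|enc N| + 24`, `E = 2^{⌊|enc N|/5⌋}`: every stage of the per-number procedure on a
number `X ≤ N` costs `O(E · (n+1)^{10})` (the exponents `2^{e₁}, 2^{e₂}, 2^{er}, ⌊√X⌋/LB₃` and the
candidate count of Algorithm 2 are all `O(E · n)`), trial division costs `O(2^{tE} (n+1)⁴)` with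
`2^{tE} ≤ 4 · 2^{n₀} · E`, and the whole machine costs at most `2^{n₀} · 10¹² · E · (n+1)^{10}`. -/

/-- The tail of the parameter blocks. [folklore] -/
theorem sfTailCost_le (n : ℕ) : sfTailCost n ≤ 310 * (n + 1) ^ 4 := by
  obtain ⟨h1, h2⟩ := cube_facts n
  have h4 : (n + 1) ^ 4 = (n + 1) * (n + 1) ^ 3 := by ring
  unfold sfTailCost
  nlinarith [powTerm_le n n _ h2]

/-- The parameter blocks. [folklore] -/
theorem cParCost_le (n : ℕ) : c1ParCost n ≤ 910 * (n + 1) ^ 4 ∧ c3ParCost n ≤ 1610 * (n + 1) ^ 4 ∧ c4ParCost n ≤ 82000 * (n + 1) ^ 4 := by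
  obtain ⟨h1, h2⟩ := cube_facts n
  have h4 : (n + 1) ^ 4 = (n + 1) * (n + 1) ^ 3 := by ring
  have hT := sfTailCost_le n
  have hI := isqrtCost_le n
  have hP := powTerm_le n n _ h2
  unfold c1ParCost c3ParCost c4ParCost
  refine ⟨by nlinarith, by nlinarith, by nlinarith⟩

/-- A call of the base search. [folklore] -/
theorem sfCallCost_le {n e M LB B : ℕ} (hML : (encodeNat (M / LB)).length ≤ n) (hB : (encodeNat B).length ≤ n) :
    sfCallCost n e M LB B ≤ 13000400 * ((B + 1) * (((e + 3) ^ 3 * 2 ^ e + M / LB + 1) * (n + 1) ^ 3)) := by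
  obtain ⟨h1, h2⟩ := cube_facts n
  have hS := sfSearchCost_le (e := e) hML hB
  have hu : (n + 1) ^ 3 ≤ (B + 1) * (((e + 3) ^ 3 * 2 ^ e + M / LB + 1) * (n + 1) ^ 3) := by
    calc (n + 1) ^ 3 ≤ ((e + 3) ^ 3 * 2 ^ e + M / LB + 1) * (n + 1) ^ 3 := Nat.le_mul_of_pos_left _ (by positivity)
      _ ≤ _ := Nat.le_mul_of_pos_left _ (by omega)
  unfold sfCallCost
  linarith

/-- `B = 2^{4|enc nN|+8} ≤ 256 (n+1)⁴` and `|enc B| ≤ n`. [folklore] -/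
theorem bOf_le (N : ℕ) : bOf N + 1 ≤ 257 * (nPar N + 1) ^ 4 ∧ (encodeNat (bOf N)).length ≤ nPar N := by
  rw [bOf, bE, nPar]
  have h1 := two_pow_len_le (encodeNat N).length
  have hl := length_encodeNat_le_self (encodeNat N).length
  constructor
  · have h2 : 2 ^ ((encodeNat (encodeNat N).length).length * 4 + 8) = (2 ^ (encodeNat (encodeNat N).length).length) ^ 4 * 256 := by rw [pow_add, pow_mul]; norm_num
    rw [h2]
    have h3 : (2 ^ (encodeNat (encodeNat N).length).length) ^ 4 ≤ (4 * (encodeNat N).length + 24 + 1) ^ 4 := Nat.pow_le_pow_left (by omega) 4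
    have h4 : 1 ≤ (4 * (encodeNat N).length + 24 + 1) ^ 4 := Nat.one_le_pow _ _ (by omega)
    omega
  · rw [encodeNat_two_pow]; simp; omega

/-- The exponents of a number of `nX ≤ nN` bits against `E = 2^{⌊nN/5⌋}`. [folklore] -/
theorem exps_le {nX nN : ℕ} (h : nX ≤ nN) :
    2 ^ cE1 nX ≤ 2 * 2 ^ (nN / 5) ∧ 2 ^ cE2 nX ≤ 2 * 2 ^ (nN / 5) ∧ 2 ^ cE3 nX ≤ 2 * 2 ^ (nN / 5) ∧ 2 ^ cER nX ≤ 2 ^ (nN / 5) ∧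
    cE1 nX + 3 ≤ 4 * nN + 25 ∧ cE2 nX + 3 ≤ 4 * nN + 25 ∧ cE3 nX + 3 ≤ 4 * nN + 25 := by
  have p1 : ∀ k, k ≤ nN / 5 + 1 → 2 ^ k ≤ 2 * 2 ^ (nN / 5) := fun k hk => by
    rw [← pow_succ']; exact Nat.pow_le_pow_right (by omega) hk
  simp only [cE1, cE2, cE3, cER]
  refine ⟨p1 _ (by omega), p1 _ (by omega), p1 _ (by omega), Nat.pow_le_pow_right (by omega) (by omega), by omega, by omega, by omega⟩

/-- The unit of a base-search stage with exponent `e` (`2^e ≤ 2E`, `e + 3 ≤ n + 1`) and class quotient `Q ≤ 2E`. [folklore] -/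
theorem stageUnit_le {n e Q E B : ℕ} (he : 2 ^ e ≤ 2 * E) (he3 : e + 3 ≤ n + 1) (hQ : Q ≤ 2 * E) (hE : 1 ≤ E) (hB : B + 1 ≤ 257 * (n + 1) ^ 4) :
    (B + 1) * (((e + 3) ^ 3 * 2 ^ e + Q + 1) * (n + 1) ^ 3) ≤ 1285 * (E * (n + 1) ^ 10) := by
  obtain ⟨h1, -⟩ := cube_facts n
  have hc3 : (e + 3) ^ 3 ≤ (n + 1) ^ 3 := Nat.pow_le_pow_left he3 3
  have hEc : E ≤ E * (n + 1) ^ 3 := Nat.le_mul_of_pos_right _ (by positivity)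
  have h11 : 1 ≤ E * (n + 1) ^ 3 := Nat.mul_pos hE (by positivity)
  have hu : (e + 3) ^ 3 * 2 ^ e + Q + 1 ≤ 5 * (E * (n + 1) ^ 3) := by
    have := Nat.mul_le_mul hc3 he; linarith
  calc (B + 1) * (((e + 3) ^ 3 * 2 ^ e + Q + 1) * (n + 1) ^ 3) ≤ (257 * (n + 1) ^ 4) * ((5 * (E * (n + 1) ^ 3)) * (n + 1) ^ 3) :=
        Nat.mul_le_mul hB (Nat.mul_le_mul_right _ hu)
    _ = 1285 * (E * (n + 1) ^ 10) := by ring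

/-- **Stages 1 and 3** cost `O(E (n+1)^{10})`, for a modulus of `nX ≤ nN` bits, `n = 4nN + 24`. [folklore] -/
theorem stage13Cost_le {nX nN n B : ℕ} (hnXN : nX ≤ nN) (hn : n = 4 * nN + 24) (hB : B + 1 ≤ 257 * (n + 1) ^ 4) (hlB : (encodeNat B).length ≤ n) :
    stage1Cost n nX B ≤ 17000000000 * (2 ^ (nN / 5) * (n + 1) ^ 10) ∧ stage3Cost n nX B ≤ 17000000000 * (2 ^ (nN / 5) * (n + 1) ^ 10) := by
  obtain ⟨h1, h2⟩ := cube_facts n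
  obtain ⟨x1, x2, -, -, l1, l2, -⟩ := exps_le hnXN
  obtain ⟨c1, c3, -⟩ := cParCost_le n
  have hE1 : 1 ≤ 2 ^ (nN / 5) := Nat.one_le_two_pow
  have h4 : (n + 1) ^ 4 ≤ 2 ^ (nN / 5) * (n + 1) ^ 10 := (Nat.pow_le_pow_right (by omega) (by omega)).trans (Nat.le_mul_of_pos_left _ hE1)
  have hML : ∀ e, e + 3 ≤ n + 1 → (encodeNat (2 ^ e * 2 ^ e / 2 ^ e)).length ≤ n := fun e he => by
    rw [Nat.mul_div_cancel _ (by positivity), encodeNat_two_pow]; simp; omega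
  have hdiv : ∀ e, 2 ^ e * 2 ^ e / 2 ^ e = 2 ^ e := fun e => Nat.mul_div_cancel _ (by positivity)
  constructor
  · have hS := sfCallCost_le (e := cE1 nX) (B := B) (hML (cE1 nX) (by omega)) hlB
    rw [hdiv] at hS
    have hK := stageUnit_le (n := n) (B := B) x1 (by omega) x1 hE1 hB
    unfold stage1Cost; simp only
    linarith
  · have hS := sfCallCost_le (e := cE2 nX) (B := B) (hML (cE2 nX) (by omega)) hlB
    rw [hdiv] at hS
    have hK := stageUnit_le (n := n) (B := B) x2 (by omega) x2 hE1 hB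
    unfold stage3Cost; simp only
    linarith

/-- The words of Algorithm 2 are short. [folklore] -/
theorem a2Words_length_le {X n α m r : ℕ} (hX1 : 1 < X) (hm1 : 1 ≤ m) (hr1 : 1 ≤ r) (hmX : m ≤ X) (hn : 2 * (encodeNat X).length + 8 ≤ n)
    (hnr : 4 * (encodeNat r).length + (encodeNat X).length + 4 ≤ n) : ∀ w ∈ a2Words X α m r, w.length ≤ 3 * n := by
  intro w hw
  have hlen : ∀ v, v ≤ X → (encodeNat v).length ≤ (encodeNat X).length := fun v hv => Brick.length_encodeNat_mono hv
  have hg := a2Words_good hX1 hr1 hm1 w hw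
  unfold GoodWord at hg
  rcases hg with ⟨v, i, hv, hi, hw⟩ | ⟨v, a, b, j, hv, ha, hb, hab, -, hjN, hw⟩
  · rw [hw]; simp only [mkWord, List.length_append, List.length_replicate, List.length_cons]
    have := hlen v hv.le; have := hlen i (by omega); omega
  · rw [hw]; simp only [mkWord, gPayload, List.length_append, List.length_replicate, List.length_cons, length_boolPair]
    have := hlen v hv.le; have := hlen j hjN
    have ha' : (encodeNat a).length ≤ (encodeNat r).length := Brick.length_encodeNat_mono (le_trans (Nat.le_mul_of_pos_right _ hb) hab)
    have hb' : (encodeNat b).length ≤ (encodeNat r).length := Brick.length_encodeNat_mono (le_trans (Nat.le_mul_of_pos_left _ ha) hab)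
    omega

/-- The candidate count of Algorithm 2 as called (`m = r = 2^{er}`) is `≤ 13 · 2^{er} (er + 2)`. [folklore] -/
theorem pairSum_call_le (X : ℕ) : pairSum X (2 ^ cER (encodeNat X).length) (2 ^ cER (encodeNat X).length) ≤ 13 * 2 ^ cER (encodeNat X).length * (cER (encodeNat X).length + 2) := by
  have hm1 : 1 ≤ 2 ^ cER (encodeNat X).length := Nat.one_le_two_pow
  have hP := pairSum_le (N := X) (m := 2 ^ cER (encodeNat X).length) (r := 2 ^ cER (encodeNat X).length) hm1 hm1
  rw [Nat.size_pow] at hP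
  -- `⌊√X⌋ + 1 ≤ 2^{⌈nX/2⌉}`, `m ⌊√m⌋ ≥ 2^{er + ⌊er/2⌋}`
  have hXlt : X < 2 ^ (encodeNat X).length := by rw [TM2Pass.length_encodeNat_eq_size]; exact Nat.lt_size_self X
  have hA : Nat.sqrt X + 1 ≤ 2 ^ (((encodeNat X).length + 1) / 2) := by
    have : X < 2 ^ (((encodeNat X).length + 1) / 2) * 2 ^ (((encodeNat X).length + 1) / 2) := by
      rw [← pow_add]; exact lt_of_lt_of_le hXlt (Nat.pow_le_pow_right (by omega) (by omega))
    exact Nat.sqrt_lt.2 this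
  have hsq : 2 ^ (cER (encodeNat X).length / 2) ≤ Nat.sqrt (2 ^ cER (encodeNat X).length) := by
    rw [Nat.le_sqrt, ← pow_add]; exact Nat.pow_le_pow_right (by omega) (by omega)
  have hden : 2 ^ (cER (encodeNat X).length + cER (encodeNat X).length / 2) ≤ 2 ^ cER (encodeNat X).length * Nat.sqrt (2 ^ cER (encodeNat X).length) := by
    rw [pow_add]; exact Nat.mul_le_mul_left _ hsq
  have hq : (Nat.sqrt X + 1) / (2 ^ cER (encodeNat X).length * Nat.sqrt (2 ^ cER (encodeNat X).length)) ≤ 8 * 2 ^ cER (encodeNat X).length := by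
    refine ((Nat.div_le_div_right hA).trans (Nat.div_le_div_left hden (by positivity))).trans ?_
    rw [show 8 * 2 ^ cER (encodeNat X).length = 2 ^ (cER (encodeNat X).length + 3) by rw [pow_add]; ring]
    rcases le_or_gt (cER (encodeNat X).length + cER (encodeNat X).length / 2) (((encodeNat X).length + 1) / 2) with hle | hlt
    · rw [Nat.pow_div hle (by omega)]; apply Nat.pow_le_pow_right (by omega); simp only [cER] at hle ⊢; omega
    · rw [Nat.div_eq_of_lt (Nat.pow_lt_pow_right (by omega) hlt)]; exact Nat.zero_le _
  calc _ ≤ _ := hP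
    _ ≤ (8 * 2 ^ cER (encodeNat X).length + 2 * 2 ^ cER (encodeNat X).length + 3 * 2 ^ cER (encodeNat X).length) * (cER (encodeNat X).length + 2) := Nat.mul_le_mul (by omega) (by omega)
    _ = 13 * 2 ^ cER (encodeNat X).length * (cER (encodeNat X).length + 2) := by ring

/-- The quotient `⌊√X⌋ / LB₃ ≤ 2^{⌊nX/5⌋}`. [folklore] -/
theorem sqrt_div_LB3_le (X : ℕ) : Nat.sqrt X / 2 ^ cL3 (encodeNat X).length ≤ 2 ^ cER (encodeNat X).length := by
  have hXlt : X < 2 ^ (encodeNat X).length := by rw [TM2Pass.length_encodeNat_eq_size]; exact Nat.lt_size_self X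
  have hs : Nat.sqrt X < 2 ^ (((encodeNat X).length + 1) / 2) := by
    refine Nat.sqrt_lt.2 ?_; rw [← pow_add]; exact lt_of_lt_of_le hXlt (Nat.pow_le_pow_right (by omega) (by omega))
  refine (Nat.div_le_div_right hs.le).trans ?_
  rcases le_or_gt (cL3 (encodeNat X).length) (((encodeNat X).length + 1) / 2) with hle | hlt
  · rw [Nat.pow_div hle (by omega)]; apply Nat.pow_le_pow_right (by omega); simp only [cL3, cER] at hle ⊢; omega
  · rw [Nat.div_eq_of_lt (Nat.pow_lt_pow_right (by omega) hlt)]; exact Nat.zero_le _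

/-- **Algorithm 2 as called by stage 5** costs `O(E (n+1)^7)`. [folklore] -/
theorem alg2Call_le {X nN n α : ℕ} (hX1 : 1 < X) (hnXN : (encodeNat X).length ≤ nN) (hn : n = 4 * nN + 24) :
    alg2Cost X n α (2 ^ cER (encodeNat X).length) (2 ^ cER (encodeNat X).length) ≤ 24000000000 * (2 ^ (nN / 5) * (n + 1) ^ 7) := by
  obtain ⟨-, -, -, xr, -, -, -⟩ := exps_le hnXN
  have hm1 : 1 ≤ 2 ^ cER (encodeNat X).length := Nat.one_le_two_pow
  have hnX1 : 1 ≤ (encodeNat X).length := by rw [TM2Pass.length_encodeNat_eq_size]; exact Nat.size_pos.2 (by omega)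
  have hmX : 2 ^ cER (encodeNat X).length ≤ X := by
    have : 2 ^ ((encodeNat X).length - 1) ≤ X := by
      rw [TM2Pass.length_encodeNat_eq_size]; exact Nat.lt_size.1 (by rw [← TM2Pass.length_encodeNat_eq_size]; omega)
    exact le_trans (Nat.pow_le_pow_right (by omega) (by simp only [cER]; omega)) this
  have hlm : (encodeNat (2 ^ cER (encodeNat X).length)).length = cER (encodeNat X).length + 1 := by rw [encodeNat_two_pow]; simp
  have hw := a2Words_length_le (α := α) (n := n) hX1 hm1 hm1 hmX (by omega) (by rw [hlm]; simp only [cER]; omega)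
  have hA := alg2Cost_le (α := α) (n := n) hX1 (by omega) hm1 hmX hm1 hmX hw
  have hPS := pairSum_call_le X
  have hsum : 2 ^ cER (encodeNat X).length + 2 ^ cER (encodeNat X).length + pairSum X (2 ^ cER (encodeNat X).length) (2 ^ cER (encodeNat X).length) + 1 ≤ 16 * (2 ^ (nN / 5) * (n + 1)) := by
    have h13 : 13 * 2 ^ cER (encodeNat X).length * (cER (encodeNat X).length + 2) ≤ 13 * (2 ^ (nN / 5) * (n + 1)) := by
      rw [mul_assoc]; apply Nat.mul_le_mul_left; exact Nat.mul_le_mul xr (by simp only [cER]; omega)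
    have : 2 ^ (nN / 5) ≤ 2 ^ (nN / 5) * (n + 1) := Nat.le_mul_of_pos_right _ (by omega)
    omega
  calc _ ≤ _ := hA
    _ ≤ 1500000000 * ((16 * (2 ^ (nN / 5) * (n + 1))) * (n + 1) ^ 6) := Nat.mul_le_mul_left _ (Nat.mul_le_mul_right _ hsum)
    _ = 24000000000 * (2 ^ (nN / 5) * (n + 1) ^ 7) := by ring

/-- **Stages 4–5** cost `O(E (n+1)^{10})`. [folklore] -/
theorem stage45Cost_le {X nN n B : ℕ} (hX1 : 1 < X) (hnXN : (encodeNat X).length ≤ nN) (hn : n = 4 * nN + 24) (hB : B + 1 ≤ 257 * (n + 1) ^ 4) (hlB : (encodeNat B).length ≤ n) :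
    stage45Cost n X B ≤ 42000000000 * (2 ^ (nN / 5) * (n + 1) ^ 10) := by
  obtain ⟨h1, h2⟩ := cube_facts n
  obtain ⟨-, -, x3, xr, -, -, l3⟩ := exps_le hnXN
  obtain ⟨-, -, c4⟩ := cParCost_le n
  have hE1 : 1 ≤ 2 ^ (nN / 5) := Nat.one_le_two_pow
  have hQ : Nat.sqrt X / 2 ^ cL3 (encodeNat X).length ≤ 2 * 2 ^ (nN / 5) := (sqrt_div_LB3_le X).trans (by omega)
  have hML : (encodeNat (Nat.sqrt X / 2 ^ cL3 (encodeNat X).length)).length ≤ n :=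
    (Brick.length_encodeNat_mono ((Nat.div_le_self _ _).trans (Nat.sqrt_le_self X))).trans (by omega)
  have hS := sfCallCost_le (e := cE3 (encodeNat X).length) (B := B) hML hlB
  have hK := stageUnit_le (n := n) (B := B) x3 (by omega) hQ hE1 hB
  have hA := alg2Call_le (α := (stage4St X B).1) hX1 hnXN hn
  have hP := powTerm_le n n _ h2
  have h4 : (n + 1) ^ 4 ≤ 2 ^ (nN / 5) * (n + 1) ^ 10 := (Nat.pow_le_pow_right (by omega) (by omega)).trans (Nat.le_mul_of_pos_left _ hE1)
  have h7 : 2 ^ (nN / 5) * (n + 1) ^ 7 ≤ 2 ^ (nN / 5) * (n + 1) ^ 10 := Nat.mul_le_mul_left _ (Nat.pow_le_pow_right (by omega) (by omega))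
  have hc4 : (n + 1) * (n + 1) ^ 3 ≤ (n + 1) ^ 4 := by rw [← pow_succ']
  have hc3 : (n + 1) ^ 3 ≤ (n + 1) ^ 4 := Nat.pow_le_pow_right (by omega) (by omega)
  unfold stage45Cost stage5Cost a2CallCost; simp only
  linarith

/-- Stage 2. [folklore] -/
theorem stage2Cost_le (n : ℕ) : stage2Cost n ≤ 80400 * (n + 1) ^ 4 := by
  unfold stage2Cost
  have := isqrtCost_le n
  have h4 : (n + 1) ^ 4 = (n + 1) * (n + 1) ^ 3 := by ring
  nlinarith [(cube_facts n).1]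

/-- **One round of the work stack** on `X ≤ N`, `X > 1` costs `O(E (n+1)^{10})`. [folklore] -/
theorem roundCost_le {N X : ℕ} (hXN : X ≤ N) (hX1 : 1 < X) :
    roundCost (nPar N) X (bOf N) + 3 ≤ 77000000000 * (2 ^ ((encodeNat N).length / 5) * (nPar N + 1) ^ 10) := by
  obtain ⟨hB, hlB⟩ := bOf_le N
  have hn : nPar N = 4 * (encodeNat N).length + 24 := rfl
  have hnXN : (encodeNat X).length ≤ (encodeNat N).length := Brick.length_encodeNat_mono hXN
  obtain ⟨s1, s3⟩ := stage13Cost_le (B := bOf N) hnXN hn hB hlB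
  have s45 := stage45Cost_le (B := bOf N) hX1 hnXN hn hB hlB
  have s2 := stage2Cost_le (nPar N)
  have hE1 : 1 ≤ 2 ^ ((encodeNat N).length / 5) := Nat.one_le_two_pow
  have h4 : (nPar N + 1) ^ 4 ≤ 2 ^ ((encodeNat N).length / 5) * (nPar N + 1) ^ 10 := (Nat.pow_le_pow_right (by omega) (by omega)).trans (Nat.le_mul_of_pos_left _ hE1)
  have h3 : (nPar N + 1) ^ 3 ≤ (nPar N + 1) ^ 4 := Nat.pow_le_pow_right (by omega) (by omega)
  obtain ⟨h1, h2⟩ := cube_facts (nPar N)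
  unfold roundCost coreCost; simp only
  linarith

/-- Stacks and prime lists of the rounds stay short. [folklore] -/
theorem roundsRun_lengths (B Xf : ℕ) : ∀ k, (roundsRun B (stack0 Xf, []) k).1.length ≤ k + 1 ∧ (roundsRun B (stack0 Xf, []) k).2.length ≤ k
  | 0 => by simp only [roundsRun, stack0]; split_ifs <;> simp
  | k + 1 => by
    obtain ⟨ih1, ih2⟩ := roundsRun_lengths B Xf k
    rw [roundsRun]
    rcases hs : roundsRun B (stack0 Xf, []) k with ⟨stk, ps⟩
    rw [hs] at ih1 ih2
    simp only at ih1 ih2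
    cases stk with
    | nil => exact ⟨by simp, by simpa using ih2.trans (Nat.le_succ k)⟩
    | cons X rest =>
      simp only [List.length_cons] at ih1
      simp only [roundStep]
      cases coreOut X B with
      | none => exact ⟨by simp only; omega, by simp only [List.length_cons]; omega⟩
      | some g => exact ⟨by simp only [List.length_cons]; omega, by simp only; omega⟩

/-- **The seven rounds** cost `O(E (n+1)^{10})`. [folklore] -/
theorem roundsCost_le (N : ℕ) : roundsCost (nPar N) (bOf N) 7 (stack0 (tdOf N).1, []) ≤ 545000000000 * (2 ^ ((encodeNat N).length / 5) * (nPar N + 1) ^ 10) := by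
  set U := 2 ^ ((encodeNat N).length / 5) * (nPar N + 1) ^ 10 with hU
  have hU1 : 1 ≤ U := Nat.mul_pos Nat.one_le_two_pow (by positivity)
  have hF : ∀ i < 7, roundsF (nPar N) (bOf N) 7 (stack0 (tdOf N).1, []) i ≤ 77000000000 * U := by
    intro i _
    unfold roundsF
    rcases hq : (roundsRun (bOf N) (stack0 (tdOf N).1, []) (7 - (i + 1))).1 with _ | ⟨X, rest⟩
    · simp only; omega
    · simp only
      rcases Nat.eq_zero_or_pos N with rfl | hN
      · exfalso
        have h0 : (tdOf 0).1 = 0 := Nat.le_zero.1 (tdRun_facts 0 _ _).1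
        rw [h0, show stack0 0 = [] by rfl, roundsRun_nil] at hq; simp at hq
      · have hgood : ∀ X, 1 < X → X ∣ (tdOf N).1 → GoodX (nPar N) (bOf N) X := fun X => goodX_of_dvd hN
        obtain ⟨hX1, hXd⟩ := (roundsRun_inv hgood (7 - (i + 1))).1 X (by rw [hq]; simp)
        have hXN : X ≤ N := (Nat.le_of_dvd (tdOf_facts hN).1 hXd).trans (tdOf_facts hN).2.1
        exact roundCost_le hXN hX1
  unfold roundsCost
  have := lsum_le_mul _ _ hF
  omega

/-- `2^{tE} ≤ 4 · 2^{n₀} · E`. [folklore] -/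
theorem two_pow_tE_le (nN : ℕ) : 2 ^ tE nN ≤ 4 * 2 ^ n₀ * 2 ^ (nN / 5) := by
  unfold tE; split_ifs with h
  · calc 2 ^ ((nN + 4) / 5 + 1) ≤ 2 ^ (nN / 5 + 2) := Nat.pow_le_pow_right (by omega) (by omega)
      _ = 4 * 1 * 2 ^ (nN / 5) := by rw [pow_add]; ring
      _ ≤ 4 * 2 ^ n₀ * 2 ^ (nN / 5) := by gcongr; exact Nat.one_le_two_pow
  · calc 2 ^ nN ≤ 2 ^ n₀ := Nat.pow_le_pow_right (by omega) (by omega)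
      _ = 1 * 2 ^ n₀ * 1 := by ring
      _ ≤ 4 * 2 ^ n₀ * 2 ^ (nN / 5) := Nat.mul_le_mul (by omega) Nat.one_le_two_pow

/-- **Trial division** costs `O(2^{tE} (n+1)⁴)`. [folklore] -/
theorem tdivCost_le (N : ℕ) : tdivCost (nPar N) (encodeNat N).length (2 ^ tE (encodeNat N).length) ≤ 2100 * 2 ^ n₀ * (2 ^ ((encodeNat N).length / 5) * (nPar N + 1) ^ 10) := by
  set n := nPar N with hn0
  set nN := (encodeNat N).length
  have hn : n = 4 * nN + 24 := by rw [hn0, nPar]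
  obtain ⟨h1, h2⟩ := cube_facts n
  have hO : tdOuterCost n nN + 2 ≤ 510 * ((n + 1) * (n + 1) ^ 3) := by
    unfold tdOuterCost tdInnerCost
    have : nN * (502 * (n + 1) ^ 3 + 4 * n + 6 + 2) ≤ nN * (510 * (n + 1) ^ 3) := Nat.mul_le_mul_left _ (by nlinarith)
    nlinarith
  have hT := two_pow_tE_le nN
  have h4 : (n + 1) * (n + 1) ^ 3 ≤ (n + 1) ^ 10 := by rw [← pow_succ']; exact Nat.pow_le_pow_right (by omega) (by omega)
  have hE1 : 1 ≤ 2 ^ n₀ * (2 ^ (nN / 5) * (n + 1) ^ 10) := Nat.mul_pos Nat.one_le_two_pow (Nat.mul_pos Nat.one_le_two_pow (by positivity))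
  have hmain : 2 ^ tE nN * (tdOuterCost n nN + 2) ≤ 2040 * 2 ^ n₀ * (2 ^ (nN / 5) * (n + 1) ^ 10) := by
    calc 2 ^ tE nN * (tdOuterCost n nN + 2) ≤ (4 * 2 ^ n₀ * 2 ^ (nN / 5)) * (510 * (n + 1) ^ 10) := Nat.mul_le_mul hT (hO.trans (Nat.mul_le_mul_left _ h4))
      _ = 2040 * 2 ^ n₀ * (2 ^ (nN / 5) * (n + 1) ^ 10) := by ring
  have h3 : (n + 1) ^ 3 ≤ 2 ^ n₀ * (2 ^ (nN / 5) * (n + 1) ^ 10) := by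
    calc (n + 1) ^ 3 ≤ (n + 1) ^ 10 := Nat.pow_le_pow_right (by omega) (by omega)
      _ ≤ _ := Nat.le_mul_of_pos_left _ Nat.one_le_two_pow |>.trans (Nat.le_mul_of_pos_left _ Nat.one_le_two_pow)
  unfold tdivCost
  linarith

/-- The initialisation. [folklore] -/
theorem initCost_le (N : ℕ) : initACost (nPar N) (encodeNat N).length + initBCost (nPar N) ≤ 2400 * 2 ^ n₀ * (2 ^ ((encodeNat N).length / 5) * (nPar N + 1) ^ 10) := by
  set n := nPar N with hn0
  set nN := (encodeNat N).length
  have hn : n = 4 * nN + 24 := by rw [hn0, nPar]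
  obtain ⟨h1, h2⟩ := cube_facts n
  have hT := two_pow_tE_le nN
  have htE : tE nN + 1 ≤ n + 1 := by unfold tE; split_ifs <;> omega
  have hU := toUnaryTerm_le (tE nN) _ h1
  have hP := powTerm_le n n _ h2
  have h4 : (n + 1) * (n + 1) ^ 3 ≤ (n + 1) ^ 10 := by rw [← pow_succ']; exact Nat.pow_le_pow_right (by omega) (by omega)
  have hmain : (tE nN + 1) * 2 ^ tE nN * (n + 1) ^ 3 ≤ 4 * 2 ^ n₀ * (2 ^ (nN / 5) * (n + 1) ^ 10) := by
    calc (tE nN + 1) * 2 ^ tE nN * (n + 1) ^ 3 ≤ (n + 1) * (4 * 2 ^ n₀ * 2 ^ (nN / 5)) * (n + 1) ^ 3 := Nat.mul_le_mul_right _ (Nat.mul_le_mul htE hT)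
      _ = 4 * 2 ^ n₀ * (2 ^ (nN / 5) * ((n + 1) * (n + 1) ^ 3)) := by ring
      _ ≤ 4 * 2 ^ n₀ * (2 ^ (nN / 5) * (n + 1) ^ 10) := by gcongr
  have h3 : (n + 1) * (n + 1) ^ 3 ≤ 2 ^ n₀ * (2 ^ (nN / 5) * (n + 1) ^ 10) :=
    h4.trans (Nat.le_mul_of_pos_left _ Nat.one_le_two_pow |>.trans (Nat.le_mul_of_pos_left _ Nat.one_le_two_pow))
  unfold initACost initBCost
  nlinarith

/-- The output list is short: at most `|enc N|` prime factors. [folklore] -/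
theorem length_factorOut_le (N : ℕ) : (factorOut N).length ≤ (encodeNat N).length := by
  rw [factorOut_eq]
  rcases Nat.eq_zero_or_pos N with rfl | hN
  · simp
  · have h1 := pow_length_le_prod N.primeFactorsList fun x hx => (Nat.prime_of_mem_primeFactorsList hx).two_le
    rw [Nat.prod_primeFactorsList (by omega)] at h1
    have hNlt : N < 2 ^ (encodeNat N).length := by rw [TM2Pass.length_encodeNat_eq_size]; exact Nat.lt_size_self N
    exact Nat.le_of_lt_succ ((Nat.pow_lt_pow_iff_right (by omega)).1 (lt_of_le_of_lt h1 (lt_of_lt_of_le hNlt (Nat.pow_le_pow_right (by omega) (Nat.le_succ _)))))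

/-- The output. [folklore] -/
theorem outputCost_le (N : ℕ) : outputCost (nPar N) (encodeNat N).length (roundsOf N).2.length (encVec (roundsOf N).1).length (encVec (factorOut N)).length
    (primeWords ((encodeNat N).length + 1) (roundsOf N).2) ≤ 5000 * (nPar N + 1) ^ 4 := by
  set n := nPar N with hn0
  set nN := (encodeNat N).length with hnN
  have hn : n = 4 * nN + 24 := by rw [hn0, nPar]
  obtain ⟨h1, h2⟩ := cube_facts n
  obtain ⟨hK8, hP7⟩ := roundsRun_lengths (bOf N) (tdOf N).1 7
  rw [show roundsRun (bOf N) (stack0 (tdOf N).1, []) 7 = roundsOf N by rfl] at hK8 hP7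
  -- sizes of the elements
  have helts : ∀ X ∈ (roundsOf N).1 ++ (roundsOf N).2, X ≤ N := by
    intro X hX
    rcases Nat.eq_zero_or_pos N with rfl | hN
    · exfalso
      have h0 : (tdOf 0).1 = 0 := Nat.le_zero.1 (tdRun_facts 0 _ _).1
      have : roundsOf 0 = ([], []) := by rw [roundsOf, h0, show stack0 0 = [] by rfl, roundsRun_nil]
      rw [this] at hX; simp at hX
    · have hgood : ∀ X, 1 < X → X ∣ (tdOf N).1 → GoodX (nPar N) (bOf N) X := fun X => goodX_of_dvd hN
      obtain ⟨i1, i2⟩ := roundsRun_inv hgood 7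
      have hd : X ∣ (tdOf N).1 := by
        rcases List.mem_append.1 hX with hX | hX
        · exact (i1 X hX).2
        · exact (i2 X hX).2
      exact (Nat.le_of_dvd (tdOf_facts hN).1 hd).trans (tdOf_facts hN).2.1
  have hlenX : ∀ X, X ≤ N → (encodeNat X).length ≤ nN := fun X hX => Brick.length_encodeNat_mono hX
  have hK : (encVec (roundsOf N).1).length ≤ 8 * (2 * nN + 2) :=
    (length_encVec_le (m := nN) fun a ha => hlenX a (helts a (List.mem_append_left _ ha))).trans (Nat.mul_le_mul_right _ hK8)
  have hFO : ∀ p ∈ factorOut N, p ≤ N := fun p hp => by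
    rw [factorOut_eq] at hp
    exact Nat.le_of_mem_primeFactorsList hp
  have hM : (encVec (factorOut N)).length ≤ nN * (2 * nN + 2) :=
    (length_encVec_le (m := nN) fun a ha => hlenX a (hFO a ha)).trans (Nat.mul_le_mul_right _ (length_factorOut_le N))
  have hws : ∀ w ∈ primeWords (nN + 1) (roundsOf N).2, w.length ≤ 3 * n := fun w hw => by
    have := (primeWords_shape (nb := nN + 1) (ps := (roundsOf N).2) (fun p hp => (hlenX p (helts p (List.mem_append_right _ hp))).trans (Nat.le_succ _)) w hw).2.1
    omega
  have hS := a2SortCost_le (n := n) (nb := nN + 1) (by omega) hws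
  have hPW : (primeWords (nN + 1) (roundsOf N).2).length ≤ 7 := by simp [primeWords]; exact hP7
  have hWP : wordsPassCost n (roundsOf N).2.length ≤ 7 * (264 * (n + 1) ^ 3 + 2) + 1 := by
    unfold wordsPassCost a2EmitCost
    have : (roundsOf N).2.length * ((11 * n + 9) + (250 * (n + 1) ^ 3 + 3 * (n + 1) ^ 3) + 2) ≤ 7 * (264 * (n + 1) ^ 3 + 2) := Nat.mul_le_mul hP7 (by nlinarith)
    omega
  have hD : decodeCost n (nN + 1) (roundsOf N).2.length ≤ 7 * (80 * (n + 1) ^ 3) + 1 := by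
    unfold decodeCost a2ScanKeyCost
    have : (roundsOf N).2.length * (11 * (nN + 1 + 1) + 9 + 13 * (n + 1) ^ 3 + ((nN + 1) * (3 + 2) + 1) + (3 * (nN + 1) + 1) + 3 + (30 * (n + 1) ^ 3 + (4 * n + 3 + 3 * (n + 1) ^ 3)) + 2) ≤ 7 * (80 * (n + 1) ^ 3) :=
      Nat.mul_le_mul hP7 (by nlinarith)
    omega
  have hP := powTerm_le n n _ h2
  have h4 : (n + 1) ^ 4 = (n + 1) * (n + 1) ^ 3 := by ring
  have hnN2 : nN * (2 * nN + 2) ≤ (n + 1) * (n + 1) ^ 3 := by nlinarith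
  unfold outputCost
  nlinarith [Nat.mul_le_mul_right ((n + 1) ^ 3) hPW]

/-- **The whole factoring machine** costs at most `2^{n₀} · 10¹² · 2^{⌊|enc N|/5⌋} · (n+1)^{10}`. [folklore] -/
theorem mainCost_le (N : ℕ) : mainCost N ≤ 2 ^ n₀ * 1000000000000 * (2 ^ ((encodeNat N).length / 5) * (nPar N + 1) ^ 10) := by
  have hI := initCost_le N
  have hT := tdivCost_le N
  have hR := roundsCost_le N
  have hO := outputCost_le N
  have h4 : (nPar N + 1) ^ 4 ≤ 2 ^ ((encodeNat N).length / 5) * (nPar N + 1) ^ 10 :=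
    (Nat.pow_le_pow_right (by omega) (by omega)).trans (Nat.le_mul_of_pos_left _ Nat.one_le_two_pow)
  have h1 : 1 ≤ 2 ^ n₀ := Nat.one_le_two_pow
  set U := 2 ^ ((encodeNat N).length / 5) * (nPar N + 1) ^ 10
  have hU : U ≤ 2 ^ n₀ * U := Nat.le_mul_of_pos_left _ h1
  unfold mainCost
  simp only
  nlinarith

end CostBoundsC

section TM2Wrapper

/-! ### The Turing machine

The stack program `mainProg` over the finite register type `EReg ⊕ HReg` is compiled to a
multi-stack Turing machine (`Com.compile`, `Com.outputsWithin_of_runs_equiv`): on `enc N` in the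
input stack it halts with `encVec (primeFactorsList N)` in the output stack within `mainCost N + 1`
steps.  A two-state finite-state transducer then rewrites the pair coding `encVec` into the
separator coding `encodeListNat` over `Option Bool` in linear time, and the composition of the two
machines (`TimeComputable.comp_holds`) is the `TM2ComputableInTime encodeNat encodeListNat
Nat.primeFactorsList` demanded by `harvey_factoring_one_fifth`, with time
`O(2^{n/5} (n+1)^{12})`. -/

deriving instance Fintype for VReg
deriving instance Fintype for NReg
deriving instance Fintype for FReg
deriving instance Fintype for GReg

/-- The machine's register names are finitely many. [folklore] -/
noncomputable instance : Fintype HReg :=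
  Fintype.ofList ([.X1, .X2, .X3, .X4, .X5, .X6, .FL1, .FL2, .U1, .U2, .L1, .L2, .L3, .L4, .SQ1, .SQ2, .SQ3, .SQ4, .SQ5, .RX1, .RX2, .RX3, .RX4, .RX5, .RX6, .RX7, .RX8, .RX9, .PTK, .PTU, .BLF, .BLA, .BLM, .BLMU, .BLE, .BLPOW, .BLC1, .BLC2, .BLFP, .BLG, .BLOUT, .BLK, .A1V, .A1I, .A1AI, .A1G, .A1P, .A1C, .A2R, .A2M, .A2AL, .A2AM, .A2C, .A2J, .A2A, .A2B, .A2JJ, .A2T, .A2V, .A2S, .A2L1, .A2L2, .A2SRT, .A2U, .A2D, .A2Y, .A2P, .A2Q, .SFM, .SFD, .SFB, .SFBMAX, .SFL, .SFK, .SFDIVS, .SFT, .SFCAND, .SFBETA, .SFE, .SFR, .MN0, .MNC, .MNF, .MNP, .MNB, .MNI, .INP, .OUTP] ++ (Finset.univ : Finset GReg).toList.map HReg.g) (by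
    intro x; cases x <;> simp)

/-- The identity naming of the machine's registers. [folklore] -/
def hId : HReg ↪ HReg := Function.Embedding.refl HReg

/-- The empty outer register file. [folklore] -/
def Tnil : Regs HReg := fun _ => []

/-- The ambient registers of the multiplier are clean in the empty file. [folklore] -/
theorem drvInv_Tnil : DrvInv (rGH hId) 0 Tnil :=
  ⟨rfl, rfl, rfl, rfl, rfl, rfl, rfl, rfl, rfl, rfl, rfl, rfl, rfl, rfl, rfl, rfl, rfl, rfl⟩

/-- The machine's variables, all empty, over the empty file: the empty file. [folklore] -/
theorem hSt_Tnil_eH : hSt hId Tnil eH = Tnil := by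
  funext x
  simp only [hSt, gSt, fSt, gBase, hBase, eH, eG, eF, Function.update_apply, Tnil]
  simp

/-- The lower banks of `base` are clean. [folklore] -/
theorem base_inl (T : Regs HReg) (r : EReg) : base T (Sum.inl r) = [] := by
  rcases r with ⟨a | m⟩ | x
  · cases a <;> rfl
  · cases m <;> rfl
  · cases x <;> rfl

/-- The initial configuration of the compiled machine is the start state of `runs_main`. [folklore] -/
theorem init_inp_eq (z : List Bool) : Regs.init (Sum.inr HReg.INP) z = base (hSt hId Tnil { eH with inp := z }) := by
  rw [← update_hSt_INP, hSt_Tnil_eH]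
  funext r
  rcases r with r | x
  · rw [base_inl]; simp [Regs.init]
  · simp only [Regs.init, base, nst, Sum.elim_inr, Function.update_apply, hId, Function.Embedding.refl_apply, Tnil, Sum.inr.injEq]

/-- The final configuration of the compiled machine is the end state of `runs_main`. [folklore] -/
theorem init_out_eq (o : List Bool) : Regs.init (Sum.inr HReg.OUTP) o = base (hSt hId Tnil { eH with outp := o }) := by
  rw [← update_hSt_OUTP, hSt_Tnil_eH]
  funext r
  rcases r with r | x
  · rw [base_inl]; simp [Regs.init]
  · simp only [Regs.init, base, nst, Sum.elim_inr, Function.update_apply, hId, Function.Embedding.refl_apply, Tnil, Sum.inr.injEq]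

/-- **The compiled factoring machine** (input and output alphabet `Bool`). [folklore] -/
noncomputable def factorMachine : Turing.TM2ComputableAux Bool Bool :=
  (Com.compile ((mainProg hId).map (Fintype.equivFin (EReg ⊕ HReg)))).toAux (Fintype.equivFin (EReg ⊕ HReg) (Sum.inr HReg.INP))
    (Fintype.equivFin (EReg ⊕ HReg) (Sum.inr HReg.OUTP))

/-- **The compiled machine factors**: on `enc N` it outputs `encVec (primeFactorsList N)` within `mainCost N + 1` steps. [folklore] -/
theorem factorMachine_outputsWithin (N : ℕ) : factorMachine.OutputsWithin (encodeNat N) (encVec (Nat.primeFactorsList N)) (mainCost N + 1) := by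
  obtain ⟨hinv, hps⟩ := rounds_hyps N
  have h := runs_main hId N Tnil drvInv_Tnil rfl hinv hps
  rw [← init_inp_eq, ← init_out_eq, factorOut_eq] at h
  exact Com.outputsWithin_of_runs_equiv (Fintype.equivFin (EReg ⊕ HReg)) (Or.inl h)

/-- The time bound of the compiled machine as a function of the input length. [folklore] -/
def factorTime (n : ℕ) : ℕ := 2 ^ n₀ * 1000000000000 * (2 ^ (n / 5) * (4 * n + 24 + 1) ^ 10) + 1

/-- **Factoring is time-computable** in the pair coding, within `factorTime`. [folklore] -/
theorem timeComputable_factor : TimeComputable encodeNat (fun l : List ℕ => encVec l) Nat.primeFactorsList factorTime :=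
  ⟨factorMachine, fun N => (factorMachine_outputsWithin N).mono (by
    have := mainCost_le N; simp only [factorTime, nPar] at this ⊢; omega)⟩

/-! #### The recoding transducer -/

/-- The step of the recoding transducer: remember the first bit of a pair, classify the pair. [folklore] -/
def sepStep : Option Bool → Bool → Option Bool × List (Option Bool)
  | none, b => (some b, [])
  | some a, b => (none, [if a = b then some a else none])

/-- The transducer from the pair coding `encVec l` (`Bool`) to `encodeListNat l` (`Option Bool`):
pairs `bb` become the letter `some b`, the pair `01` becomes the separator `none`. [folklore] -/
def sepFST : FST (Option Bool) Bool (Option Bool) where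
  init := none
  step := sepStep
  front _ := []
  keep _ := true

/-- Reading a doubled block. [folklore] -/
theorem sepFST_run_dbl (w : List Bool) (rest : List Bool) :
    sepFST.run none ((w.flatMap fun b => [b, b]) ++ rest) = ((sepFST.run none rest).1, w.map some ++ (sepFST.run none rest).2) := by
  induction w with
  | nil => simp
  | cons b w ih =>
    rw [List.flatMap_cons, List.append_assoc]
    show sepFST.run none (b :: b :: (List.flatMap (fun b => [b, b]) w ++ rest)) = _
    rw [FST.run_cons, show (sepFST.step none b) = (some b, []) from rfl, FST.run_cons, show (sepFST.step (some b) b) = (none, [some b]) by simp [sepFST, sepStep], ih]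
    simp

/-- Reading the separator. [folklore] -/
theorem sepFST_run_sep (rest : List Bool) : sepFST.run none (false :: true :: rest) = ((sepFST.run none rest).1, none :: (sepFST.run none rest).2) := by
  rw [FST.run_cons, show (sepFST.step none false) = (some false, []) from rfl, FST.run_cons, show (sepFST.step (some false) true) = (none, [none]) from rfl]
  rfl

/-- **The transducer recodes**: `sepFST.eval (encVec l) = encodeListNat l`. [folklore] -/
theorem sepFST_eval (l : List ℕ) : sepFST.eval (encVec l) = Literature.Computability.Cryptography.encodeListNat l := by
  have hrun : ∀ l : List ℕ, (sepFST.run none (encVec l)).2 = Literature.Computability.Cryptography.encodeListNat l := by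
    intro l
    induction l with
    | nil => simp [Literature.Computability.Cryptography.encodeListNat]
    | cons x l ih =>
      rw [Literature.Computability.Cryptography.encodeListNat_cons, encVec, List.map_cons, encList_cons, boolPair, List.append_assoc, sepFST_run_dbl, ← encVec,
        show [false, true] ++ encVec l = false :: true :: encVec l from rfl, sepFST_run_sep, ih]
  show sepFST.front (sepFST.run sepFST.init (encVec l)).1 ++ (if sepFST.keep (sepFST.run sepFST.init (encVec l)).1 then (sepFST.run sepFST.init (encVec l)).2 else []) = _
  simp only [sepFST] at hrun ⊢
  simpa using hrun l

/-- **The recoding is time-computable** in linear time. [folklore] -/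
theorem timeComputable_recode : TimeComputable (fun l : List ℕ => encVec l) Literature.Computability.Cryptography.encodeListNat (id : List ℕ → List ℕ)
    (fun n => (sepFST.maxEmit + 1) * n + 3) := by
  obtain ⟨M, hM⟩ := sepFST.timeComputable_eval
  refine ⟨M, fun l => ?_⟩
  have := hM (encVec l)
  rw [sepFST_eval] at this
  exact this

/-! #### The theorem -/

/-- The length of the pair-coded factorisation. [folklore] -/
theorem length_encVec_factors_le (N : ℕ) : (encVec (Nat.primeFactorsList N)).length ≤ (encodeNat N).length * (2 * (encodeNat N).length + 2) := by
  rw [← factorOut_eq]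
  refine (length_encVec_le (m := (encodeNat N).length) fun a ha => ?_).trans (Nat.mul_le_mul_right _ (length_factorOut_le N))
  rw [factorOut_eq] at ha
  exact Brick.length_encodeNat_mono (Nat.le_of_mem_primeFactorsList ha)

/-- Powers of two against real powers: `2^{⌊n/5⌋} ≤ 2^{n/5}`. [folklore] -/
theorem two_pow_div_le_rpow (n : ℕ) : ((2 ^ (n / 5) : ℕ) : ℝ) ≤ (2 : ℝ) ^ ((n : ℝ) / 5) := by
  rw [Nat.cast_pow, Nat.cast_ofNat, ← Real.rpow_natCast]
  exact Real.rpow_le_rpow_of_exponent_le one_le_two (Nat.cast_div_le.trans (by norm_num))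

/-- **Harvey's theorem, machine form**: a `TM2` machine computes `Nat.primeFactorsList` (binary
in, `encodeListNat` out) in time `C · 2^{n/5} · (n+1)^{12}`.
[cite: Harvey2021, Thm. 1.1 (arXiv v3 Thm. 1)] -/
theorem exists_factoring_machine : ∃ (M : Turing.TM2ComputableInTime encodeNat Literature.Computability.Cryptography.encodeListNat Nat.primeFactorsList) (C : ℝ),
    ∀ n : ℕ, (M.time n : ℝ) ≤ C * ((2 : ℝ) ^ ((n : ℝ) / 5) * ((n : ℝ) + 1) ^ 12) := by
  obtain ⟨c, hc⟩ := TimeComputable.comp_holds (g := (id : List ℕ → List ℕ)) (f := Nat.primeFactorsList) (s := fun n => n * (2 * n + 2))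
    timeComputable_recode timeComputable_factor (fun a b hab => Nat.add_le_add_right (Nat.mul_le_mul_left _ hab) 3) (fun N => length_encVec_factors_le N)
  rw [Function.id_comp] at hc
  obtain ⟨M, hM⟩ := timeComputable_iff_exists_TM2ComputableInTime.1 hc
  -- the bound in `ℕ`
  obtain ⟨K, hK⟩ : ∃ K : ℕ, ∀ n, c * (factorTime n + ((sepFST.maxEmit + 1) * (n * (2 * n + 2)) + 3) + n * (2 * n + 2)) + c ≤ K * (2 ^ (n / 5) * (n + 1) ^ 12) := by
    refine ⟨c * (2 ^ n₀ * 1000000000000 * 25 ^ 10 + (sepFST.maxEmit + 3) * 4 + 8) + c, fun n => ?_⟩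
    have h1 : 1 ≤ 2 ^ (n / 5) := Nat.one_le_two_pow
    have hp : (4 * n + 24 + 1) ^ 10 ≤ 25 ^ 10 * (n + 1) ^ 10 := by rw [← mul_pow]; exact Nat.pow_le_pow_left (by omega) 10
    have h12 : (n + 1) ^ 10 ≤ (n + 1) ^ 12 := Nat.pow_le_pow_right (by omega) (by omega)
    have hq : n * (2 * n + 2) ≤ 2 * (n + 1) ^ 12 := by
      have : (n + 1) ^ 2 ≤ (n + 1) ^ 12 := Nat.pow_le_pow_right (by omega) (by omega)
      nlinarith
    have hU : 1 ≤ 2 ^ (n / 5) * (n + 1) ^ 12 := Nat.mul_pos h1 (by positivity)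
    have hft : factorTime n ≤ (2 ^ n₀ * 1000000000000 * 25 ^ 10) * (2 ^ (n / 5) * (n + 1) ^ 12) + 1 := by
      unfold factorTime
      have := Nat.mul_le_mul_left (2 ^ n₀ * 1000000000000) (Nat.mul_le_mul_left (2 ^ (n / 5)) (hp.trans (Nat.mul_le_mul_left _ h12)))
      linarith
    have hq2 : n * (2 * n + 2) ≤ 2 * (2 ^ (n / 5) * (n + 1) ^ 12) := hq.trans (Nat.mul_le_mul_left _ (Nat.le_mul_of_pos_left _ h1))
    have hmid : (sepFST.maxEmit + 1) * (n * (2 * n + 2)) + 3 + n * (2 * n + 2) ≤ ((sepFST.maxEmit + 3) * 4 + 7) * (2 ^ (n / 5) * (n + 1) ^ 12) := by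
      have := Nat.mul_le_mul_left (sepFST.maxEmit + 1) hq2
      nlinarith
    have k1 := Nat.mul_le_mul_left c hft
    have k2 := Nat.mul_le_mul_left c hmid
    have k3 := Nat.mul_le_mul_left c hU
    nlinarith
  refine ⟨M, K, fun n => ?_⟩
  have h1 := (hM n).trans (hK n)
  have h3 : ((2 ^ (n / 5) * (n + 1) ^ 12 : ℕ) : ℝ) ≤ (2 : ℝ) ^ ((n : ℝ) / 5) * ((n : ℝ) + 1) ^ 12 := by
    push_cast
    exact mul_le_mul_of_nonneg_right (by exact_mod_cast two_pow_div_le_rpow n) (by positivity)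
  calc (M.time n : ℝ) ≤ ((K * (2 ^ (n / 5) * (n + 1) ^ 12) : ℕ) : ℝ) := by exact_mod_cast h1
    _ = (K : ℝ) * ((2 ^ (n / 5) * (n + 1) ^ 12 : ℕ) : ℝ) := by push_cast; ring
    _ ≤ (K : ℝ) * ((2 : ℝ) ^ ((n : ℝ) / 5) * ((n : ℝ) + 1) ^ 12) := mul_le_mul_of_nonneg_left h3 (by positivity)

end TM2Wrapper

end Com

end Literature.Computability.Complexity
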